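import Literature.NumberTheory.GaloisRepresentations.IdeleTorusHasseCovariant
import Literature.NumberTheory.GaloisRepresentations.TateH2VanishingTwoAllFields
import Literature.NumberTheory.GaloisRepresentations.TateSpinLiftContinuousH2Proofs
import Literature.NumberTheory.GaloisRepresentations.TateSpinLiftContinuous
import Literature.NumberTheory.GaloisCohomology.LocalInvariantMapConjCompatible
import Literature.NumberTheory.GaloisCohomology.Howard2004.EngineDecompositionsOfSkewPairingIntendedProofs
import Literature.NumberTheory.GaloisCohomology.Howard2004.TowerZModLeftKernelPairingProofs
import Literature.NumberTheory.GaloisCohomology.Howard2004.CasselsTateSkewPairingPrintIntended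
import Literature.NumberTheory.GaloisCohomology.PoitouTateFiniteAnnihilators
import Literature.NumberTheory.GaloisCohomology.PoitouTateFiniteShaThreeRealPlaces
import Literature.NumberTheory.GaloisCohomology.PoitouTateFiniteUnramifiedTransport
import Literature.NumberTheory.GaloisCohomology.PoitouTateFiniteSelmerShaDual
import Literature.NumberTheory.GaloisCohomology.PoitouTateFiniteShaTwoReal
import Literature.NumberTheory.GaloisCohomology.PoitouTateFiniteLocalDualityReduction
import Literature.NumberTheory.GaloisRepresentations.IdeleClassBarInvariantCompare
import HarnessLib

/-!
# Poitou–Tate duality for finite modules, 7/7: `Ш¹`-duality, the `ℤ/m`–`μ_m` instance, Tate's `H²(Γ_K, ℚ/ℤ) = 0` for every number field — eight named facts HOLD (re-homed proofs)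

**Poitou–Tate duality for finite Galois modules over number fields and its consequences, proved in the tree's vocabulary from the idèle
class formation (Milne, *Arithmetic Duality Theorems* I §2, §4; Tate, ICM 1962; Harari 2020 Ch. 17–18; Serre, Durham 1977 §6): the named facts
`Literature.NumberTheory.GaloisCohomology.poitouTate_sha_tateDual` (PT (ii): `Ш¹(K, M)` and `Ш¹(K, M^D)` are exact annihilators, `PoitouTateSha.lean`),
`…poitouTate_sha_zmod_mu` (its `ℤ/m` / `μ_m` instance), `…poitouTate_three_realPlaces_injective` (Milne I Thm. 4.10 (c), degree 3,
`PoitouTateRealPlacesHigherDegree.lean`), `…poitouTate_selmerStructure_duality_conj` (duality for Selmer structures with conjugation-compatible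
canonical invariants, `PoitouTateSelmerStructuresConj.lean`), `Literature.NumberTheory.GaloisRepresentations.Patrikis2019_exists_lift_projective` / `…_exists_spinLift` /
`…_exists_spinLift_of_continuous` (Tate's `H²(Γ_K, ℚ/ℤ) = 0` and Patrikis' lifting statements, `ProjectiveLifting.lean`, `TateSpinLift.lean`,
`TateSpinLiftContinuous.lean`) and `Literature.NumberTheory.GaloisCohomology.Howard2004.prop141_casselsTate_skewPairing_atLevel_printIntended` /
`…thm161_dvrKolyvaginBound_printIntended` (Howard 2004 Prop. 1.4.1 / Thm. 1.6.1 as intended, `Howard2004/`) HOLD — EXACT names `<fact>_holds`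
(files 2 and 7 of 7).**  Contents: (1, definitions file) annihilators under a perfect `ℤ/n`-valued pairing of finite abelian groups and their counting
(Milne I §0), descent of `2`-cocycles through an open normal subgroup, the trivial module `ℤ/m` versus `μ_m` (transport maps); (2) `Ш³` and
`H³(K, M) → ⊕_{v real}` injectivity via the Brauer group (`H³(Γ_K, K̄ˣ) = 0`, odd descent, Sylow fields); (3) unramified local conditions,
inertia and the unramified subgroup, local Tate pairing vanishing on unramified classes, exact orthogonality at almost all places, bidual transport,
the all-places reduction, presentation read-out and the reciprocity equality; (4) finiteness of Selmer groups, finite duality of `Ш`-duals, new places,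
`Ш²` read-out roads, weak Leopoldt; (5) the real-place corrections, native `Ш²` assembly, presentation pairings, the idèle package and the reciprocity
sum; (6) local duality at every place, the Selmer-complement reduction, unramified orthogonality at all levels, the all-places reduction, the
middle-exact dual symmetry; (7) `Ш¹`-duality `poitouTate_sha_tateDual_holds`, the `ℤ/m`–`μ_m` instance, `H²`-finite support, Tate's theorem
`H²(Γ_K, ℚ/ℤ) = 0` for every number field and the Patrikis / Howard / Selmer-structure discharges.
RE-HOMED into `Literature/` by the Hodge foundations lane (`lit-hodgefound`, seat p20, generation 40): verbatim DECLARATION-LEVEL ports (the 221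
declarations needed, in dependency order; each Part is a slice of one Summits module) of 63 modules
`Summits/BirchSwinnertonDyer/BirchSwinnertonDyer/Theorems/{SchneiderFreeAdditiveX3PoitouTate*,SchneiderFreeAdditiveX3TateH2VanishingAllNumberFields,
CumulativeHeegnerLeopoldtRedSplitControlAtThreeSha*,ThetaPartnerAtTwoSignedControlAtTwo{MuReal*,ShaTwo*,ShaThree*,GlobalHTwoFiniteSupport},
KolyvaginRoadThreePTDevissageCofinite,PoitouTateSelmerStructureDualityConjHolds,Howard{Thm161PrintIntendedOfProp141Intended,FlachSkewPairingAtLevelIntendedHolds}}.lean`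
and `Summits/BirchSwinnertonDyer/Rank1Residual/{X11b,GaloisImage}/*.lean`; the namespaces `Summit.BirchSwinnertonDyer.BirchSwinnertonDyer.Theorems[.SchneiderFreeAdditiveX3]`
and `Summit.BirchSwinnertonDyer.Rank1Residual` are re-rooted at `Literature.NumberTheory.GaloisCohomology.PoitouTateFinite` (sub-namespaces `PoitouTateReduction`,
`PoitouTateShaTwoReadout`, `PoitouTateShaAnnihilator`, `SignedEC.*`, `KolyvaginRoadThreePT`, `InputsPoitouTateSelmer`, `Howard*`, `GaloisImage.*` kept; the route-item
segment `X11b` is dropped: `…X11b.{FiniteDuality,Levels,LocBridge,H2Support,ShaBound,WeakLeopoldt}` ↦ `PoitouTateFinite.{…}`);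
four lemmas of `X11b/MaxUnramifiedRestriction.lean` already in `Literature/NumberTheory/GaloisRepresentations/UnramifiedClassesInertia.lean` are used from
there; the nine `_holds` theorems carry the EXACT names.  Built on the tree's Literature layer (`Literature/NumberTheory/{GaloisRepresentations,GaloisCohomology,
Automorphic,EllipticCurves}/…`, `Literature/Algebra/Homology/…`, `Literature/AnabelianGeometry/AbsoluteAnabelian/…`).  No new named fact (D-0026); imports
Mathlib/Literature only; every declaration carries the citation of the printed statement it formalises or serves.  The Summits originals stay in
place (transitional duplication).  WHAT THIS IS NOT: nothing here bears on the Birch–Swinnerton-Dyer conjecture or any summit statement; it is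
classical Poitou–Tate duality for finite modules (1960s) re-proved in the tree's vocabulary.
-/

noncomputable section

/-!
## Part 1 — port of `Summits/BirchSwinnertonDyer/BirchSwinnertonDyer/Theorems/ThetaPartnerAtTwoSignedControlAtTwoShaTwoReadoutRoadReal.lean` (2 declarations kept)

# Poitou–Tate, degree two, at fields WITH REAL PLACES: the `Ш²`-readout road (WITHOUT `IsTotallyComplex` — archimedean components live (Milne ADT I Thm. 4.10 (a), proof p. 58)

Declarations of this Part (verbatim port; each keeps its own docstring and citation): `shaTwo_tateDual_of_presentation_readout_real`, `shaTwo_tateDual_of_ideleProjection_real`.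

Reference keys (see `references.bib` and the declarations' citations): [MilneADT2006], [Harari2020].
-/

section Part1

open _root_.Function _root_.NumberField _root_.IsDedekindDomain _root_.CategoryTheory CategoryTheory.Abelian
open scoped _root_.NumberField

set_option autoImplicit false

namespace Literature.NumberTheory.GaloisCohomology.PoitouTateFinite.PoitouTateShaTwoReadout

open _root_.Field
open Literature.NumberTheory.GaloisRepresentations Literature.NumberTheory.GaloisCohomology
open Literature.NumberTheory.GaloisRepresentations.DiscreteGaloisModule (TateDual tateDual localTatePairingZMod
  unramifiedSubgroup sha shaTwo)
open Literature.Algebra.Homology Literature.Algebra.Homology.DiscreteRep Literature.Algebra.Homology.ExtPresentation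
open Literature.NumberTheory.GaloisRepresentations.IdeleClassBar (classBarD)
open Literature.AnabelianGeometry.AbsoluteAnabelian.Prop121vii (zmodToQmodZ zmodToQmodZ_injective)
open Literature.NumberTheory.GaloisCohomology.PoitouTateFinite.SignedEC.MuReal (sha_tateDual_of_readout_real)
open Literature.NumberTheory.GaloisCohomology.PoitouTateFinite.PoitouTateReduction
  (unramifiedOrthogonal_of_isPerfect_allLevels)
open Literature.NumberTheory.GaloisCohomology.PoitouTateFinite.KolyvaginRoadThreePT
  (exists_finset_localization_mem_unramifiedSubgroup)

/-! ## §1 The `Ш²`-readout road, any number field -/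

section Road

variable {K : Type} [Field K] [NumberField K]

/-- **Milne I Thm. 4.10 (a) at one module from the presentation road plus a degree-`2` obstruction map — ANY number field
(real places allowed).**  `n ≥ 1`, `ρ` a finite discrete `n`-torsion `Γ_K`-module unramified off the finite
`S₀ ⊇ {v ∣ ∞} ∪ {v ∣ n}`, `Ш¹(K, M^D)` finite; the canonical local invariant maps satisfy `SelmerComplement` at level `n`
(= the output of `hE(n)`).  Given the degree-`≤ 1` package of the presentation road — an invariant map `inv` of `C̄`, a short
exact `S : 0 → N₁ → N₂ → N → 0` in `C_Γ` with `α¹(Γ_K, N)` bijective and `Ext¹(N₂, C̄) = 0`, a readout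
`R_v : Hom(N₁, J̄) → H¹(K_v, M)` with the surjectivity (R3) (ALL places), and an additive bijection `nat : H¹(K, M^D) ≅ Ext¹(ℤ, N)`
with the pairing identity (R4) `(1/n)·∑_{v ∈ T'} inv_v(R_v f ∪ loc_v y) = inv(nat y ∘ ∂(f ≫ g))` (archimedean summands
included) — and the degree-`2` package — an additive `Ψ : Hom(N₁, C̄) → H²(K, M)` with `Ψ(f ≫ g) = 0`, `Ψ(ι ≫ q) = 0`,
`Ψ h = 0 ⟹ h = f ≫ g`, `Ψ h ∈ Ш²(K, M)`, `Ш²(K, M) ⊆ Im Ψ` — the group `Ш²(K, M)` is finite and there is a bi-additive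
`b : Ш²(K, M) × Ш¹(K, M^D) → ℤ/n` both of whose adjoints are bijective (verbatim the conclusion of `poitouTate_sha_tateDual K`
at `(n, M, ρ)`).  Proof: the readout `e` and its additivity / injectivity / surjectivity modulo sums of local Tate pairings
are constructed exactly as in `shaTwo_tateDual_of_presentation_readout` (archimedean components of the test families live);
the pairing is `SignedEC.MuReal.sha_tateDual_of_readout_real` for `LocalInvariants.canonical K n`
(`canonical_isPerfect`, `canonical_injectiveAtRealPlaces`, Milne I 2.6 at all levels, `SelmerComplement`).
[cite: MilneADT2006, Ch. I, Thm. 4.10 (a) (proof, p. 58), Thm. 2.13 (a), Lemma 4.13, Thm. 1.8][cite: Harari2020, Thm. 17.13 (b), §16.3] -/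
theorem shaTwo_tateDual_of_presentation_readout_real {n : ℕ} [NeZero n]
    (hcomp : (LocalInvariants.canonical K n).SelmerComplement)
    {M : Type} [AddCommGroup M] [TopologicalSpace M] [DiscreteTopology M] [Finite M]
    (ρ : DiscreteGaloisModule K M) (hM : ∀ m : M, n • m = 0)
    (S₀ : Finset (Place K)) (hinf : ∀ w : InfinitePlace K, (Sum.inl w : Place K) ∈ S₀)
    (hS₀ : ∀ v : HeightOneSpectrum (𝓞 K), (Sum.inr v : Place K) ∉ S₀ →
      ((n : ℕ) : 𝓞 K) ∉ v.asIdeal ∧ GaloisRep.IsUnramifiedAt v ρ)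
    [Finite (sha (ρ.tateDual n))]
    (inv : Abelian.Ext (triv (Γ := absoluteGaloisGroup K) ℤ) (classBarD K) 2 →+ AddCircle (1 : ℚ))
    {S : ShortComplex (DiscreteRepCat ℤ (absoluteGaloisGroup K))} (hS : S.ShortExact)
    (hα : Function.Bijective
      (ExtDuality.adjointMap (P := triv (Γ := absoluteGaloisGroup K) ℤ) inv S.X₃ (rfl : 1 + 1 = 2)))
    (hPC : ∀ x : Abelian.Ext S.X₂ (classBarD K) 1, x = 0)
    (R : ∀ v : Place K, (S.X₁ ⟶ (ideleClassLimitShortComplex K).X₂) →+ galoisCohomology (ρ.toLocal v) 1)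
    (hR3 : ∀ T : Finset (Place K), (∀ w : InfinitePlace K, (Sum.inl w : Place K) ∈ T) →
      (∀ v : HeightOneSpectrum (𝓞 K), (Sum.inr v : Place K) ∉ T →
        ((n : ℕ) : 𝓞 K) ∉ v.asIdeal ∧ GaloisRep.IsUnramifiedAt v ρ) →
      ∀ t : Π v : Place K, galoisCohomology (ρ.toLocal v) 1,
        (∀ v : HeightOneSpectrum (𝓞 K), (Sum.inr v : Place K) ∉ T →
          t (Sum.inr v) ∈ unramifiedSubgroup (GaloisRep.toLocal v ρ) 1) →
        ∃ f : S.X₁ ⟶ (ideleClassLimitShortComplex K).X₂, ∀ v : Place K, R v f = t v)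
    (nat : galoisCohomology (ρ.tateDual n) 1 →+ Abelian.Ext (triv (Γ := absoluteGaloisGroup K) ℤ) S.X₃ 1)
    (hnat : Function.Bijective nat)
    (hR4 : ∀ f : S.X₁ ⟶ (ideleClassLimitShortComplex K).X₂, ∃ Tf : Finset (Place K),
      ∀ (y : galoisCohomology (ρ.tateDual n) 1) (T' : Finset (Place K)), Tf ⊆ T' →
        (∀ v : HeightOneSpectrum (𝓞 K), (Sum.inr v : Place K) ∉ T' →
          galoisCohomology.localization (ρ.tateDual n) (Sum.inr v) 1 y ∈
            unramifiedSubgroup (GaloisRep.toLocal v (ρ.tateDual n)) 1) →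
        zmodToQmodZ n (∑ v ∈ T', localTatePairingZMod ρ n v (LocalInvariants.canonical K n v) (R v f)
          (galoisCohomology.localization (ρ.tateDual n) v 1 y)) =
        inv ((nat y).comp (boundary hS (classBarD K) (f ≫ (ideleClassLimitShortComplex K).g))
          (rfl : 1 + 1 = 2)))
    (Ψ : (S.X₁ ⟶ classBarD K) →+ galoisCohomology ρ 2)
    (hΨg : ∀ f : S.X₁ ⟶ (ideleClassLimitShortComplex K).X₂, Ψ (f ≫ (ideleClassLimitShortComplex K).g) = 0)
    (hΨf : ∀ q : S.X₂ ⟶ classBarD K, Ψ (S.f ≫ q) = 0)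
    (hΨker : ∀ h : S.X₁ ⟶ classBarD K, Ψ h = 0 →
      ∃ f : S.X₁ ⟶ (ideleClassLimitShortComplex K).X₂, h = f ≫ (ideleClassLimitShortComplex K).g)
    (hΨsha : ∀ h : S.X₁ ⟶ classBarD K, Ψ h ∈ shaTwo ρ)
    (hΨsurj : ∀ c ∈ shaTwo ρ, ∃ h : S.X₁ ⟶ classBarD K, Ψ h = c) :
    Finite (shaTwo ρ) ∧ ∃ b : shaTwo ρ →+ sha (ρ.tateDual n) →+ ZMod n,
      Function.Bijective b ∧ Function.Bijective b.flip := by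
  classical
  -- `H¹(K, M^D)` is `n`-torsion
  have hN1 : ∀ y : galoisCohomology (ρ.tateDual n) 1, n • y = 0 := fun y =>
    galoisCohomology.nsmul_eq_zero_of_forall _ (fun f => DiscreteGaloisModule.TateDual.nsmul_eq_zero f) y
  -- the bridge as an additive equivalence
  let natE : galoisCohomology (ρ.tateDual n) 1 ≃+
      Abelian.Ext (triv (Γ := absoluteGaloisGroup K) ℤ) S.X₃ 1 := AddEquiv.ofBijective nat hnat
  have hnatE : ∀ y, natE y = nat y := fun _ => rfl
  -- the `ℚ/ℤ`-valued functional `y ↦ inv (nat y ∘ ∂ h)` of a homomorphism `h : N₁ → C̄`, additive in `h`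
  let EH : (S.X₁ ⟶ classBarD K) →+ (galoisCohomology (ρ.tateDual n) 1 →+ AddCircle (1 : ℚ)) :=
    AddMonoidHom.mk' (fun h =>
      (ExtDuality.adjointMap (P := triv (Γ := absoluteGaloisGroup K) ℤ) inv S.X₃ (rfl : 1 + 1 = 2)
        (boundary hS (classBarD K) h)).comp nat)
      (fun h h' => by rw [map_add, map_add, AddMonoidHom.add_comp])
  have hEH : ∀ (h : S.X₁ ⟶ classBarD K) (y : galoisCohomology (ρ.tateDual n) 1),
      EH h y = inv ((nat y).comp (boundary hS (classBarD K) h) (rfl : 1 + 1 = 2)) := fun _ _ => rfl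
  -- its `ℤ/n`-valued lift
  have hfac : ∀ h : S.X₁ ⟶ classBarD K, ∃ φ : galoisCohomology (ρ.tateDual n) 1 →+ ZMod n,
      ∀ y, zmodToQmodZ n (φ y) = EH h y := fun h => exists_addMonoidHom_zmodToQmodZ_eq hN1 (EH h)
  choose eh heh using hfac
  have heh_sub : ∀ (h h' : S.X₁ ⟶ classBarD K) (y : galoisCohomology (ρ.tateDual n) 1),
      eh (h - h') y = eh h y - eh h' y := fun h h' y => by
    apply zmodToQmodZ_injective n
    rw [map_sub, heh, heh, heh, map_sub, AddMonoidHom.sub_apply]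
  -- lifts of the `Ш²`-classes along `Ψ`
  choose lift hlift using hΨsurj
  -- THE READOUT
  let e : shaTwo ρ → (galoisCohomology (ρ.tateDual n) 1 →+ ZMod n) := fun c => eh (lift c.1 c.2)
  have he : ∀ c : shaTwo ρ, e c = eh (lift c.1 c.2) := fun _ => rfl
  -- the functional of `f ≫ g` is a local sum: (R4), read in `ℤ/n`
  have hloc : ∀ f : S.X₁ ⟶ (ideleClassLimitShortComplex K).X₂, ∃ Tf : Finset (Place K),
      ∀ (y : galoisCohomology (ρ.tateDual n) 1) (T' : Finset (Place K)), Tf ⊆ T' →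
        (∀ v : HeightOneSpectrum (𝓞 K), (Sum.inr v : Place K) ∉ T' →
          galoisCohomology.localization (ρ.tateDual n) (Sum.inr v) 1 y ∈
            unramifiedSubgroup (GaloisRep.toLocal v (ρ.tateDual n)) 1) →
        eh (f ≫ (ideleClassLimitShortComplex K).g) y =
          ∑ v ∈ T', localTatePairingZMod ρ n v (LocalInvariants.canonical K n v) (R v f)
            (galoisCohomology.localization (ρ.tateDual n) v 1 y) := by
    intro f
    obtain ⟨Tf, hTf⟩ := hR4 f
    refine ⟨Tf, fun y T' hT' hy => ?_⟩
    apply zmodToQmodZ_injective n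
    rw [heh, hEH, hTf y T' hT' hy]
  -- every class is unramified off a finite set of places
  have hur_y : ∀ (y : galoisCohomology (ρ.tateDual n) 1) (T₀ : Finset (Place K)), ∃ T' : Finset (Place K),
      T₀ ⊆ T' ∧ ∀ v : HeightOneSpectrum (𝓞 K), (Sum.inr v : Place K) ∉ T' →
        galoisCohomology.localization (ρ.tateDual n) (Sum.inr v) 1 y ∈
          unramifiedSubgroup (GaloisRep.toLocal v (ρ.tateDual n)) 1 := by
    intro y T₀
    obtain ⟨Ty, hTy⟩ := exists_finset_localization_mem_unramifiedSubgroup (ρ.tateDual n) y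
    refine ⟨T₀ ∪ Ty.image Sum.inr, Finset.subset_union_left, fun v hv => hTy v fun hvT => hv ?_⟩
    exact Finset.mem_union_right _ (Finset.mem_image_of_mem _ hvT)
  -- two homomorphisms with the same functional differ by `ι ≫ q`, so have the same `Ψ`
  have hΨ_eq_of_EH : ∀ h h' : S.X₁ ⟶ classBarD K, EH h = EH h' → Ψ h = Ψ h' := by
    intro h h' hhh
    have h1 : ExtDuality.adjointMap (P := triv (Γ := absoluteGaloisGroup K) ℤ) inv S.X₃ (rfl : 1 + 1 = 2)
        (boundary hS (classBarD K) h) =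
        ExtDuality.adjointMap (P := triv (Γ := absoluteGaloisGroup K) ℤ) inv S.X₃ (rfl : 1 + 1 = 2)
        (boundary hS (classBarD K) h') :=
      (AddMonoidHom.cancel_right hnat.2).1 hhh
    have h2 : boundary hS (classBarD K) h = boundary hS (classBarD K) h' := hα.1 h1
    obtain ⟨q, hq⟩ := (boundary_eq_boundary_iff hS h h').1 h2
    rw [hq, map_add, hΨf, add_zero]
  -- (add): `e` is additive modulo local sums
  have hadd : ∀ c c' : shaTwo ρ, ∃ (S₁ : Finset (Place K)) (t : Π v : Place K, galoisCohomology (ρ.toLocal v) 1),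
      ∀ (y : galoisCohomology (ρ.tateDual n) 1) (S' : Finset (Place K)), S₁ ⊆ S' →
        (∀ v : HeightOneSpectrum (𝓞 K), (Sum.inr v : Place K) ∉ S' →
          galoisCohomology.localization (ρ.tateDual n) (Sum.inr v) 1 y ∈
            unramifiedSubgroup (GaloisRep.toLocal v (ρ.tateDual n)) 1) →
        (e (c + c') - e c - e c') y = ∑ v ∈ S', localTatePairingZMod ρ n v (LocalInvariants.canonical K n v) (t v)
          (galoisCohomology.localization (ρ.tateDual n) v 1 y) := by
    intro c c'
    set d : S.X₁ ⟶ classBarD K := lift (c + c').1 (c + c').2 - lift c.1 c.2 - lift c'.1 c'.2 with hd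
    have hΨd : Ψ d = 0 := by
      rw [hd, map_sub, map_sub, hlift, hlift, hlift, AddSubgroup.coe_add, add_sub_cancel_left, sub_self]
    obtain ⟨f, hf⟩ := hΨker d hΨd
    obtain ⟨Tf, hTf⟩ := hloc f
    refine ⟨Tf, fun v => R v f, fun y S' hS' hy => ?_⟩
    rw [AddMonoidHom.sub_apply, AddMonoidHom.sub_apply, he, he, he, ← heh_sub, ← heh_sub, ← hd, hf]
    exact hTf y S' hS' hy
  -- (inj): a class whose readout is a local sum vanishes (archimedean components of the test family live)
  have hinj : ∀ c : shaTwo ρ, (∃ (S₁ : Finset (Place K)) (t : Π v : Place K, galoisCohomology (ρ.toLocal v) 1),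
      S₀ ⊆ S₁ ∧
      (∀ v : HeightOneSpectrum (𝓞 K), (Sum.inr v : Place K) ∉ S₁ →
        t (Sum.inr v) ∈ unramifiedSubgroup (GaloisRep.toLocal v ρ) 1) ∧
      ∀ (y : galoisCohomology (ρ.tateDual n) 1) (S' : Finset (Place K)), S₁ ⊆ S' →
        (∀ v : HeightOneSpectrum (𝓞 K), (Sum.inr v : Place K) ∉ S' →
          galoisCohomology.localization (ρ.tateDual n) (Sum.inr v) 1 y ∈
            unramifiedSubgroup (GaloisRep.toLocal v (ρ.tateDual n)) 1) →
        e c y = ∑ v ∈ S', localTatePairingZMod ρ n v (LocalInvariants.canonical K n v) (t v)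
          (galoisCohomology.localization (ρ.tateDual n) v 1 y)) → c = 0 := by
    rintro c ⟨S₁, t, hS₀S₁, htur, hct⟩
    -- `t` is the readout of one `f : N₁ → J̄` (R3)
    obtain ⟨f, hf⟩ := hR3 S₁ (fun w => hS₀S₁ (hinf w)) (fun v hv => hS₀ v fun hv' => hv (hS₀S₁ hv')) t htur
    obtain ⟨Tf, hTf⟩ := hloc f
    -- the functionals of `h_c` and of `f ≫ g` agree
    have hfun : EH (lift c.1 c.2) = EH (f ≫ (ideleClassLimitShortComplex K).g) := by
      ext y
      obtain ⟨S', hS', hy⟩ := hur_y y (S₁ ∪ Tf)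
      have h1 : e c y = ∑ v ∈ S', localTatePairingZMod ρ n v (LocalInvariants.canonical K n v) (t v)
          (galoisCohomology.localization (ρ.tateDual n) v 1 y) :=
        hct y S' (Finset.union_subset_left hS') hy
      have h2 := hTf y S' (Finset.union_subset_right hS') hy
      rw [← heh, ← heh, ← he, h1, h2]
      exact congrArg _ (Finset.sum_congr rfl fun v _ => by rw [hf v])
    have hΨ := hΨ_eq_of_EH _ _ hfun
    rw [hlift, hΨg] at hΨ
    exact Subtype.ext hΨ
  -- (surj): every character of `H¹(K, M^D)` is a readout plus a local sum
  have hsurj : ∀ φ : galoisCohomology (ρ.tateDual n) 1 →+ ZMod n, ∃ (c : shaTwo ρ) (S₁ : Finset (Place K))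
      (t : Π v : Place K, galoisCohomology (ρ.toLocal v) 1),
      ∀ (y : galoisCohomology (ρ.tateDual n) 1) (S' : Finset (Place K)), S₁ ⊆ S' →
        (∀ v : HeightOneSpectrum (𝓞 K), (Sum.inr v : Place K) ∉ S' →
          galoisCohomology.localization (ρ.tateDual n) (Sum.inr v) 1 y ∈
            unramifiedSubgroup (GaloisRep.toLocal v (ρ.tateDual n)) 1) →
        (φ - e c) y = ∑ v ∈ S', localTatePairingZMod ρ n v (LocalInvariants.canonical K n v) (t v)
          (galoisCohomology.localization (ρ.tateDual n) v 1 y) := by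
    intro φ
    -- the character read on `Ext¹(ℤ, N)` through `nat`, as `α¹(∂ h)`
    let Φ : Abelian.Ext (triv (Γ := absoluteGaloisGroup K) ℤ) S.X₃ 1 →+ AddCircle (1 : ℚ) :=
      ((zmodToQmodZ n).comp φ).comp natE.symm.toAddMonoidHom
    have hΦ : ∀ y, Φ (nat y) = zmodToQmodZ n (φ y) := fun y => by
      change zmodToQmodZ n (φ (natE.symm (nat y))) = _
      rw [← hnatE, AddEquiv.symm_apply_apply]
    obtain ⟨x, hx⟩ := hα.2 Φ
    obtain ⟨h, hh⟩ := boundary_surjective hS hPC x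
    have hEHh : ∀ y, EH h y = zmodToQmodZ n (φ y) := fun y => by
      rw [← hΦ, ← hx, ← hh]
      rfl
    let c : shaTwo ρ := ⟨Ψ h, hΨsha h⟩
    have hΨd : Ψ (lift c.1 c.2 - h) = 0 := by rw [map_sub, hlift, sub_self]
    obtain ⟨f, hf⟩ := hΨker _ hΨd
    obtain ⟨Tf, hTf⟩ := hloc (-f)
    refine ⟨c, Tf, fun v => R v (-f), fun y S' hS' hy => ?_⟩
    have hneg : h - lift c.1 c.2 = (-f) ≫ (ideleClassLimitShortComplex K).g := by
      rw [← neg_sub, hf]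
      exact (Preadditive.neg_comp _ _).symm
    -- (rewrite at the level of values: `Hom(N₁, T.X₃)` and `Hom(N₁, C̄)` agree only up to unfolding)
    have key : eh (h - lift c.1 c.2) y = eh ((-f) ≫ (ideleClassLimitShortComplex K).g) y :=
      DFunLike.congr_fun (congrArg eh hneg) y
    rw [← hTf y S' hS' hy, ← key, heh_sub, AddMonoidHom.sub_apply, he]
    congr 1
    apply zmodToQmodZ_injective n
    rw [heh, hEHh]
  -- lead g4's theorem for the canonical family, every number field (archimedean local duality, Milne I 2.13 (a))
  obtain ⟨hfin, b, -, hb, hbflip⟩ :=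
    sha_tateDual_of_readout_real LocalInvariants.canonical_isPerfect LocalInvariants.canonical_injectiveAtRealPlaces
      (unramifiedOrthogonal_of_isPerfect_allLevels _ LocalInvariants.canonical_isPerfect) hcomp ρ hM S₀ hinf hS₀
      e hadd hinj hsurj
  exact ⟨hfin, b, hb, hbflip⟩

end Road

/-! ## §2 The road RUN on door-c4's canonical presentation, any number field -/

section Instantiated

variable {K : Type} [Field K] [NumberField K]

open Literature.NumberTheory.GaloisRepresentations.FreePresentation (presentationComplex presentationComplex_shortExact
  presLattice presentationLayer presentationRank)
open Literature.NumberTheory.GaloisRepresentations.HomDual (IdeleProjection readout)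

/-- **The `Ш²`-readout road on the canonical presentation — ANY number field (real places allowed).**  For a finite
`n`-torsion `ρ₀` on `M₀` with door-c4's presentation `S = presentationComplex ρ₀` (`0 → N₁ → ℤ[Gal(E₀/K)]ᵐ → M₀ → 0`), the
module `ρ := ρ₀^D`, the idèle readout `R_v := HomDual.readout ρ₀ n hM (π v)` of a family `π` of idèle projections (ALL places),
and an invariant map `inv` of `C̄` satisfying door-c4's `TateDualityHypotheses` (record landed as
`IdeleClassBar.tateDualityHypotheses_classBarD_classBarInvD`), `Ext¹(ℤ[Gal(E₀/K)]ᵐ, C̄) = 0` being chl-p2 g6's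
`ext_presLattice_classBarD_eq_zero`: IF (R3) holds for the idèle readout, a bridge `nat : H¹(K, M₀^{DD}) ≅ Ext¹(ℤ, M₀)` satisfies
the (R4) identity (archimedean summands included), a degree-`2` map `Ψ : Hom(N₁, C̄) → H²(K, M₀^D)` has the five properties,
and the canonical invariant maps satisfy `SelmerComplement` at level `n`, THEN `Ш²(K, M₀^D)` is finite and perfectly paired
with `Ш¹(K, M₀^{DD})` into `ℤ/n` — the conclusion of `poitouTate_sha_tateDual K` at the module `ρ₀^D`.  Verbatim
`shaTwo_tateDual_of_ideleProjection` minus `[IsTotallyComplex K]`.  HONEST FRAMING: a reduction; closes nothing.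
[cite: MilneADT2006, Ch. I, Thm. 4.10 (a) (proof, p. 58), Thm. 2.13 (a), Lemma 4.13, Thm. 1.8][cite: Harari2020, Thm. 17.13 (b)] -/
theorem shaTwo_tateDual_of_ideleProjection_real {n : ℕ} [NeZero n]
    (hcomp : (LocalInvariants.canonical K n).SelmerComplement)
    (inv : Abelian.Ext (triv (Γ := absoluteGaloisGroup K) ℤ) (classBarD K) 2 →+ AddCircle (1 : ℚ))
    (hT : TateDualityHypotheses (classBarD K) inv) (π : ∀ v : Place K, IdeleProjection K v)
    {M : Type} [AddCommGroup M] [TopologicalSpace M] [DiscreteTopology M] [Finite M] [Finite (TateDual K M n)]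
    (ρ₀ : DiscreteGaloisModule K M) (hM : ∀ m : M, n • m = 0)
    (S₀ : Finset (Place K)) (hinf : ∀ w : InfinitePlace K, (Sum.inl w : Place K) ∈ S₀)
    (hS₀ : ∀ v : HeightOneSpectrum (𝓞 K), (Sum.inr v : Place K) ∉ S₀ →
      ((n : ℕ) : 𝓞 K) ∉ v.asIdeal ∧ GaloisRep.IsUnramifiedAt v (ρ₀.tateDual n))
    [Finite (sha ((ρ₀.tateDual n).tateDual n))]
    (hR3 : ∀ T : Finset (Place K), (∀ w : InfinitePlace K, (Sum.inl w : Place K) ∈ T) →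
      (∀ v : HeightOneSpectrum (𝓞 K), (Sum.inr v : Place K) ∉ T →
        ((n : ℕ) : 𝓞 K) ∉ v.asIdeal ∧ GaloisRep.IsUnramifiedAt v (ρ₀.tateDual n)) →
      ∀ t : Π v : Place K, galoisCohomology ((ρ₀.tateDual n).toLocal v) 1,
        (∀ v : HeightOneSpectrum (𝓞 K), (Sum.inr v : Place K) ∉ T →
          t (Sum.inr v) ∈ unramifiedSubgroup (GaloisRep.toLocal v (ρ₀.tateDual n)) 1) →
        ∃ f : (presentationComplex ρ₀).X₁ ⟶ (ideleClassLimitShortComplex K).X₂,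
          ∀ v : Place K, readout ρ₀ n hM (π v) f = t v)
    (nat : galoisCohomology ((ρ₀.tateDual n).tateDual n) 1 →+
      Abelian.Ext (triv (Γ := absoluteGaloisGroup K) ℤ) (presentationComplex ρ₀).X₃ 1)
    (hnat : Function.Bijective nat)
    (hR4 : ∀ f : (presentationComplex ρ₀).X₁ ⟶ (ideleClassLimitShortComplex K).X₂, ∃ Tf : Finset (Place K),
      ∀ (y : galoisCohomology ((ρ₀.tateDual n).tateDual n) 1) (T' : Finset (Place K)), Tf ⊆ T' →
        (∀ v : HeightOneSpectrum (𝓞 K), (Sum.inr v : Place K) ∉ T' →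
          galoisCohomology.localization ((ρ₀.tateDual n).tateDual n) (Sum.inr v) 1 y ∈
            unramifiedSubgroup (GaloisRep.toLocal v ((ρ₀.tateDual n).tateDual n)) 1) →
        zmodToQmodZ n (∑ v ∈ T', localTatePairingZMod (ρ₀.tateDual n) n v (LocalInvariants.canonical K n v)
          (readout ρ₀ n hM (π v) f)
          (galoisCohomology.localization ((ρ₀.tateDual n).tateDual n) v 1 y)) =
        inv ((nat y).comp (boundary (presentationComplex_shortExact ρ₀) (classBarD K)
          (f ≫ (ideleClassLimitShortComplex K).g)) (rfl : 1 + 1 = 2)))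
    (Ψ : ((presentationComplex ρ₀).X₁ ⟶ classBarD K) →+ galoisCohomology (ρ₀.tateDual n) 2)
    (hΨg : ∀ f : (presentationComplex ρ₀).X₁ ⟶ (ideleClassLimitShortComplex K).X₂,
      Ψ (f ≫ (ideleClassLimitShortComplex K).g) = 0)
    (hΨf : ∀ q : (presentationComplex ρ₀).X₂ ⟶ classBarD K, Ψ ((presentationComplex ρ₀).f ≫ q) = 0)
    (hΨker : ∀ h : (presentationComplex ρ₀).X₁ ⟶ classBarD K, Ψ h = 0 →
      ∃ f : (presentationComplex ρ₀).X₁ ⟶ (ideleClassLimitShortComplex K).X₂, h = f ≫ (ideleClassLimitShortComplex K).g)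
    (hΨsha : ∀ h : (presentationComplex ρ₀).X₁ ⟶ classBarD K, Ψ h ∈ shaTwo (ρ₀.tateDual n))
    (hΨsurj : ∀ c ∈ shaTwo (ρ₀.tateDual n), ∃ h : (presentationComplex ρ₀).X₁ ⟶ classBarD K, Ψ h = c) :
    Finite (shaTwo (ρ₀.tateDual n)) ∧
      ∃ b : shaTwo (ρ₀.tateDual n) →+ sha ((ρ₀.tateDual n).tateDual n) →+ ZMod n,
        Function.Bijective b ∧ Function.Bijective b.flip := by
  haveI := absoluteGaloisGroup_compactSpace K
  haveI : Finite (presentationComplex ρ₀).X₃.obj.V := ‹Finite M›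
  have hα : Function.Bijective
      (ExtDuality.adjointMap (P := triv (Γ := absoluteGaloisGroup K) ℤ) inv (presentationComplex ρ₀).X₃
        (rfl : 1 + 1 = 2)) :=
    (tateDuality_finite hT (presentationComplex ρ₀).X₃).2.1
  exact shaTwo_tateDual_of_presentation_readout_real hcomp (ρ₀.tateDual n)
    (fun Φ => DiscreteGaloisModule.TateDual.nsmul_eq_zero Φ) S₀ hinf hS₀ inv (presentationComplex_shortExact ρ₀) hα
    (fun x => ext_presLattice_classBarD_eq_zero (presentationLayer ρ₀) (presentationRank ρ₀) x)
    (fun v => readout ρ₀ n hM (π v)) hR3 nat hnat hR4 Ψ hΨg hΨf hΨker hΨsha hΨsurj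

end Instantiated

end Literature.NumberTheory.GaloisCohomology.PoitouTateFinite.PoitouTateShaTwoReadout

end Part1

/-!
## Part 2 — port of `Summits/BirchSwinnertonDyer/BirchSwinnertonDyer/Theorems/ThetaPartnerAtTwoSignedControlAtTwoShaTwoNativeAssemblyReal.lean` (3 declarations kept)

# Poitou–Tate, degree two, at fields WITH REAL PLACES: `poitouTate_sha_tateDual K` for EVERY number field from the degree-`≤ 1` package and Milne I Lemma 4.13 in the forms (A), (B)

Declarations of this Part (verbatim port; each keeps its own docstring and citation): `shaTwo_tateDual_of_shaTwoConnecting_real`, `poitouTate_sha_tateDual_of_shaTwoConnecting_real`, `poitouTate_sha_tateDual_of_localGlobal_real`.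

Reference keys (see `references.bib` and the declarations' citations): [Harari2020], [MilneADT2006], [CasselsFrohlichANT1967].
-/

section Part2

open _root_.Function _root_.NumberField _root_.IsDedekindDomain _root_.CategoryTheory CategoryTheory.Abelian
open scoped _root_.NumberField ContRepresentation

set_option autoImplicit false

namespace Literature.NumberTheory.GaloisCohomology.PoitouTateFinite.PoitouTateShaTwoReadout

open _root_.Field
open Literature.NumberTheory.GaloisRepresentations Literature.NumberTheory.GaloisCohomology
open Literature.NumberTheory.GaloisRepresentations.DiscreteGaloisModule (TateDual tateDual localTatePairingZMod
  unramifiedSubgroup sha shaTwo SelmerStructure mem_sha_iff mem_shaTwo_iff)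
open Literature.Algebra.Homology Literature.Algebra.Homology.DiscreteRep Literature.Algebra.Homology.ExtPresentation
open Literature.NumberTheory.GaloisRepresentations.IdeleClassBar (classBarD)
open Literature.AnabelianGeometry.AbsoluteAnabelian.Prop121vii (zmodToQmodZ)
open Literature.NumberTheory.GaloisRepresentations.FreePresentation (presentationComplex presentationComplex_shortExact)
open Literature.NumberTheory.GaloisRepresentations.HomDual (IdeleProjection readout shaTwoConnecting shaTwoConnecting_comp_g'
  shaTwoConnecting_f_comp exists_comp_g_eq_of_shaTwoConnecting_eq_zero shaTwoConnecting_mem_shaTwo)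
open Literature.NumberTheory.GaloisCohomology.PoitouTateFinite.PoitouTateReduction
  (exists_bidual_intertwining)
open Literature.NumberTheory.GaloisCohomology.PoitouTateFinite.SignedEC.MuReal (exists_finset_place_isUnramifiedAt)

section Plugged

variable {K : Type} [Field K] [NumberField K]

/-- **Milne I Thm. 4.10 (a) at the module `M₀^D`, from the presentation road with the NATIVE obstruction map plugged in —
ANY number field.**  For `n ≥ 1`, a finite `n`-torsion `ρ₀` on `M₀`: IF Tate duality holds for `(Γ_K, C̄, inv)` , a family `π` of idèle projections has the (R3) property for the idèle readout (all places), a bijection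
`nat : H¹(K, M₀^{DD}) ≅ Ext¹(ℤ, M₀)` satisfies the (R4) identity (archimedean summands included), the canonical invariant maps
satisfy `SelmerComplement` at level `n`, and (e) the native obstruction map `Ψ' = shaTwoConnecting ρ₀ n hM` EXHAUSTS `Ш²(K, M₀^D)`,
THEN `Ш²(K, M₀^D)` is finite and perfectly paired with `Ш¹(K, M₀^{DD})` into `ℤ/n`.  Properties (a)(b)(c)(d) of `Ψ'` are theorems
(`HomDualShaTwoConnecting`; (d) at every place), the ramification set `S₀` and the finiteness of `Ш¹` are produced inside.
Verbatim chl-p2 g7's `shaTwo_tateDual_of_shaTwoConnecting` minus `[IsTotallyComplex K]`.  HONEST FRAMING: a reduction; closes nothing.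
[cite: MilneADT2006, Ch. I, Thm. 4.10 (a) (proof, p. 58), Thm. 2.13 (a), Lemma 4.8, Lemma 4.13][cite: Harari2020, Thm. 17.13 (b)] -/
theorem shaTwo_tateDual_of_shaTwoConnecting_real {n : ℕ} [NeZero n]
    (hcomp : (LocalInvariants.canonical K n).SelmerComplement)
    (inv : Abelian.Ext (triv (Γ := absoluteGaloisGroup K) ℤ) (classBarD K) 2 →+ AddCircle (1 : ℚ))
    (hT : TateDualityHypotheses (classBarD K) inv) (π : ∀ v : Place K, IdeleProjection K v)
    {M : Type} [AddCommGroup M] [TopologicalSpace M] [DiscreteTopology M] [Finite M] [Finite (TateDual K M n)]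
    (ρ₀ : DiscreteGaloisModule K M) (hM : ∀ m : M, n • m = 0)
    (hR3 : ∀ T : Finset (Place K), (∀ w : InfinitePlace K, (Sum.inl w : Place K) ∈ T) →
      (∀ v : HeightOneSpectrum (𝓞 K), (Sum.inr v : Place K) ∉ T →
        ((n : ℕ) : 𝓞 K) ∉ v.asIdeal ∧ GaloisRep.IsUnramifiedAt v (ρ₀.tateDual n)) →
      ∀ t : Π v : Place K, galoisCohomology ((ρ₀.tateDual n).toLocal v) 1,
        (∀ v : HeightOneSpectrum (𝓞 K), (Sum.inr v : Place K) ∉ T →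
          t (Sum.inr v) ∈ unramifiedSubgroup (GaloisRep.toLocal v (ρ₀.tateDual n)) 1) →
        ∃ f : (presentationComplex ρ₀).X₁ ⟶ (ideleClassLimitShortComplex K).X₂,
          ∀ v : Place K, readout ρ₀ n hM (π v) f = t v)
    (nat : galoisCohomology ((ρ₀.tateDual n).tateDual n) 1 →+
      Abelian.Ext (triv (Γ := absoluteGaloisGroup K) ℤ) (presentationComplex ρ₀).X₃ 1)
    (hnat : Function.Bijective nat)
    (hR4 : ∀ f : (presentationComplex ρ₀).X₁ ⟶ (ideleClassLimitShortComplex K).X₂, ∃ Tf : Finset (Place K),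
      ∀ (y : galoisCohomology ((ρ₀.tateDual n).tateDual n) 1) (T' : Finset (Place K)), Tf ⊆ T' →
        (∀ v : HeightOneSpectrum (𝓞 K), (Sum.inr v : Place K) ∉ T' →
          galoisCohomology.localization ((ρ₀.tateDual n).tateDual n) (Sum.inr v) 1 y ∈
            unramifiedSubgroup (GaloisRep.toLocal v ((ρ₀.tateDual n).tateDual n)) 1) →
        zmodToQmodZ n (∑ v ∈ T', localTatePairingZMod (ρ₀.tateDual n) n v (LocalInvariants.canonical K n v)
          (readout ρ₀ n hM (π v) f)
          (galoisCohomology.localization ((ρ₀.tateDual n).tateDual n) v 1 y)) =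
        inv ((nat y).comp (boundary (presentationComplex_shortExact ρ₀) (classBarD K)
          (f ≫ (ideleClassLimitShortComplex K).g)) (rfl : 1 + 1 = 2)))
    (hΨsurj : ∀ c ∈ shaTwo (ρ₀.tateDual n), ∃ h : (presentationComplex ρ₀).X₁ ⟶ classBarD K,
      shaTwoConnecting ρ₀ n hM h = c) :
    Finite (shaTwo (ρ₀.tateDual n)) ∧
      ∃ b : shaTwo (ρ₀.tateDual n) →+ sha ((ρ₀.tateDual n).tateDual n) →+ ZMod n,
        Function.Bijective b ∧ Function.Bijective b.flip := by
  haveI : Finite (TateDual K (TateDual K M n) n) := DiscreteGaloisModule.TateDual.finite K _ n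
  -- the ramification set of `M₀^D` and the finiteness of `Ш¹(K, M₀^{DD})` are theorems
  obtain ⟨S₀, hinf, hS₀⟩ := exists_finset_place_isUnramifiedAt (ρ₀.tateDual n) n
  obtain ⟨S₁, hinf₁, hS₁⟩ := exists_finset_place_isUnramifiedAt ((ρ₀.tateDual n).tateDual n) n
  haveI : Finite (sha ((ρ₀.tateDual n).tateDual n)) :=
    finite_sha_of_isUnramifiedOutside _ S₁ hinf₁ fun v hv => (hS₁ v hv).2
  exact shaTwo_tateDual_of_ideleProjection_real hcomp inv hT π ρ₀ hM S₀ hinf hS₀ hR3 nat hnat hR4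
    (shaTwoConnecting ρ₀ n hM) (fun f => shaTwoConnecting_comp_g' ρ₀ n hM f) (shaTwoConnecting_f_comp ρ₀ n hM)
    (exists_comp_g_eq_of_shaTwoConnecting_eq_zero ρ₀ n hM) (shaTwoConnecting_mem_shaTwo ρ₀ n hM π) hΨsurj

end Plugged

section Assembly

variable {K : Type} [Field K] [NumberField K]

/-- **THE NAMED FACT `poitouTate_sha_tateDual K` (Milne I Thm. 4.10 (a): `Ш²(K, M)` and `Ш¹(K, M^D)` finite and perfectly
paired into `ℤ/n`, all `n ≥ 1`, all finite `n`-torsion `M`) for ANY number field `K` — real places allowed, `K = ℚ` is K4 —,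
from the presentation road of cell `bsd-schneider` plus the NATIVE degree-`2` obstruction map.**  Inputs, each quantified
over all levels `n ≥ 1` and all finite `n`-torsion modules `M₀`: `SelmerComplement` of the canonical invariant maps (= `hE(n)`);
Tate duality for `(Γ_K, C̄, inv)` ; ONE family `π` of idèle projections with the
(R3) property for the idèle readout of the canonical presentation; the bridge `nat` with the (R4) identity (archimedean
summands included); and (e) `Ш²(K, M₀^D) ⊆ Im (shaTwoConnecting ρ₀ n hM)`.  The pairing for `M` is transported from the road's
pairing for `(Ш²(K, M^{DD}), Ш¹(K, M^{DDD}))` along the biduality `M ≅ M^{DD}` (`nonempty_shaTwo_addEquiv_real`).  Verbatim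
chl-p2 g7's `poitouTate_sha_tateDual_of_shaTwoConnecting` minus `[IsTotallyComplex K]`.  HONEST FRAMING: a reduction with
displayed hypotheses; no case of BSD.
[cite: MilneADT2006, Ch. I, Thm. 4.10 (a) (proof, p. 58), Thm. 2.13 (a), Lemma 4.8, Prop. 0.19][cite: Harari2020, Thm. 17.13 (b)] -/
theorem poitouTate_sha_tateDual_of_shaTwoConnecting_real
    (hcomp : ∀ (n : ℕ) [NeZero n], (LocalInvariants.canonical K n).SelmerComplement)
    (inv : Abelian.Ext (triv (Γ := absoluteGaloisGroup K) ℤ) (classBarD K) 2 →+ AddCircle (1 : ℚ))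
    (hT : TateDualityHypotheses (classBarD K) inv) (π : ∀ v : Place K, IdeleProjection K v)
    (hR3 : ∀ (n : ℕ) [NeZero n],
      ∀ ⦃M : Type⦄ [AddCommGroup M] [TopologicalSpace M] [DiscreteTopology M] [Finite M] [Finite (TateDual K M n)]
      (ρ₀ : DiscreteGaloisModule K M) (hM : ∀ m : M, n • m = 0),
      ∀ T : Finset (Place K), (∀ w : InfinitePlace K, (Sum.inl w : Place K) ∈ T) →
        (∀ v : HeightOneSpectrum (𝓞 K), (Sum.inr v : Place K) ∉ T →
          ((n : ℕ) : 𝓞 K) ∉ v.asIdeal ∧ GaloisRep.IsUnramifiedAt v (ρ₀.tateDual n)) →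
        ∀ t : Π v : Place K, galoisCohomology ((ρ₀.tateDual n).toLocal v) 1,
          (∀ v : HeightOneSpectrum (𝓞 K), (Sum.inr v : Place K) ∉ T →
            t (Sum.inr v) ∈ unramifiedSubgroup (GaloisRep.toLocal v (ρ₀.tateDual n)) 1) →
          ∃ f : (presentationComplex ρ₀).X₁ ⟶ (ideleClassLimitShortComplex K).X₂,
            ∀ v : Place K, readout ρ₀ n hM (π v) f = t v)
    (hR4 : ∀ (n : ℕ) [NeZero n],
      ∀ ⦃M : Type⦄ [AddCommGroup M] [TopologicalSpace M] [DiscreteTopology M] [Finite M] [Finite (TateDual K M n)]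
      (ρ₀ : DiscreteGaloisModule K M) (hM : ∀ m : M, n • m = 0),
      ∃ nat : galoisCohomology ((ρ₀.tateDual n).tateDual n) 1 →+
          Abelian.Ext (triv (Γ := absoluteGaloisGroup K) ℤ) (presentationComplex ρ₀).X₃ 1,
        Function.Bijective nat ∧
        ∀ f : (presentationComplex ρ₀).X₁ ⟶ (ideleClassLimitShortComplex K).X₂, ∃ Tf : Finset (Place K),
          ∀ (y : galoisCohomology ((ρ₀.tateDual n).tateDual n) 1) (T' : Finset (Place K)), Tf ⊆ T' →
            (∀ v : HeightOneSpectrum (𝓞 K), (Sum.inr v : Place K) ∉ T' →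
              galoisCohomology.localization ((ρ₀.tateDual n).tateDual n) (Sum.inr v) 1 y ∈
                unramifiedSubgroup (GaloisRep.toLocal v ((ρ₀.tateDual n).tateDual n)) 1) →
            zmodToQmodZ n (∑ v ∈ T', localTatePairingZMod (ρ₀.tateDual n) n v (LocalInvariants.canonical K n v)
              (readout ρ₀ n hM (π v) f)
              (galoisCohomology.localization ((ρ₀.tateDual n).tateDual n) v 1 y)) =
            inv ((nat y).comp (boundary (presentationComplex_shortExact ρ₀) (classBarD K)
              (f ≫ (ideleClassLimitShortComplex K).g)) (rfl : 1 + 1 = 2)))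
    (hΨsurj : ∀ (n : ℕ) [NeZero n],
      ∀ ⦃M : Type⦄ [AddCommGroup M] [TopologicalSpace M] [DiscreteTopology M] [Finite M]
      (ρ₀ : DiscreteGaloisModule K M) (hM : ∀ m : M, n • m = 0),
        ∀ c ∈ shaTwo (ρ₀.tateDual n), ∃ h : (presentationComplex ρ₀).X₁ ⟶ classBarD K,
          shaTwoConnecting ρ₀ n hM h = c) :
    poitouTate_sha_tateDual K := by
  intro n _ M _ _ _ _ ρ hM
  haveI : Finite (TateDual K M n) := DiscreteGaloisModule.TateDual.finite K M n
  haveI : Finite (TateDual K (TateDual K M n) n) := DiscreteGaloisModule.TateDual.finite K _ n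
  haveI : Finite (TateDual K (TateDual K (TateDual K M n) n) n) := DiscreteGaloisModule.TateDual.finite K _ n
  -- the module to present: `ρ₀ := ρ^D`, so that the road speaks about `Ш²(ρ^{DD})` and `Ш¹(ρ^{DDD})`
  set ρ₀ : DiscreteGaloisModule K (TateDual K M n) := ρ.tateDual n with hρ₀
  have hM₀ : ∀ m : TateDual K M n, n • m = 0 := fun m => DiscreteGaloisModule.TateDual.nsmul_eq_zero m
  -- finiteness of `Ш¹(K, M^D)`
  obtain ⟨S₂, hinf₂, hS₂⟩ := exists_finset_place_isUnramifiedAt (ρ.tateDual n) n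
  haveI hfin1 : Finite (sha (ρ.tateDual n)) :=
    finite_sha_of_isUnramifiedOutside _ S₂ hinf₂ fun v hv => (hS₂ v hv).2
  -- the road at `ρ₀`
  obtain ⟨nat, hnat, hR4'⟩ := hR4 n ρ₀ hM₀
  obtain ⟨hfin2', b, hb, hbflip⟩ := shaTwo_tateDual_of_shaTwoConnecting_real (hcomp n) inv hT π ρ₀ hM₀ (hR3 n ρ₀ hM₀)
    nat hnat hR4' (hΨsurj n ρ₀ hM₀)
  -- biduality `M ≅ M^{DD}` and `M^D ≅ M^{DDD}`
  obtain ⟨ι, κ, -, hκι, hικ⟩ := exists_bidual_intertwining (n := n) ρ hM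
  obtain ⟨ι', κ', -, hκι', hικ'⟩ := exists_bidual_intertwining (n := n) (ρ.tateDual n) hM₀
  obtain ⟨eA⟩ : Nonempty (shaTwo ρ ≃+ shaTwo (ρ₀.tateDual n)) := nonempty_shaTwo_addEquiv_real ι κ hκι hικ
  obtain ⟨eB⟩ : Nonempty (sha (ρ.tateDual n) ≃+ sha ((ρ₀.tateDual n).tateDual n)) :=
    nonempty_sha_addEquiv ι' κ' hκι' hικ'
  haveI := hfin2'
  obtain ⟨b', -, hb', hb'flip⟩ := exists_perfect_of_addEquiv eA eB b hb hbflip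
  exact ⟨hfin1, Finite.of_equiv _ eA.toEquiv.symm, b', hb', hb'flip⟩

end Assembly

section LocalGlobal

variable {K : Type} [Field K] [NumberField K]

open Literature.NumberTheory.GaloisRepresentations.HomDual (exists_shaTwoConnecting_eq_of_localGlobal dualF homF postcompResHom
  unitsTransfer unitsToIdeleI)
open Literature.NumberTheory.GaloisRepresentations.FreePresentation (presModule₁ presModule₂ presProj moduleFinite_presModule₁
  moduleFinite_presModule₂)
open Literature.NumberTheory.GaloisRepresentations.DGMBridge (toDGM)
open Literature.NumberTheory.GaloisRepresentations.DiscreteGaloisModule (units)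

/-- **THE NAMED FACT `poitouTate_sha_tateDual K` for ANY number field `K` (real places allowed; `K = ℚ` is K4), with (e)
replaced by Milne I Lemma 4.13 in the two Lean-typed forms (A), (B) of `HomDual.exists_shaTwoConnecting_eq_of_localGlobal`.**
Inputs, over all levels `n ≥ 1` and all finite `n`-torsion `M₀`: `SelmerComplement` of the canonical invariant maps (= `hE`),
the Tate duality record for `(Γ_K, C̄, inv)` (landed), ONE family `π` of idèle projections with (R3), the bridge `nat` with
(R4) (archimedean summands included), and
(A) for `c ∈ Ш²(K, M₀^D)` the class `H²(p^*)(H²(e) c) ∈ H²(K, Hom_ℤ(P, K̄ˣ))` vanishes (local–global principle for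
`H²(K, Hom(P, K̄ˣ)) ≅ Br(K(M₀))^{|M₀|}`: Brauer–Hasse–Noether + Shapiro), (B) a class of `H¹(K, Hom_ℤ(N₁, K̄ˣ))` whose transfers
to all completions vanish dies in `H¹(K, Hom_ℤ(N₁, J̄))` (Milne I 4.13 in degree `1` for the relation lattice).  Verbatim
chl-p2 g7's `poitouTate_sha_tateDual_of_localGlobal` minus `[IsTotallyComplex K]`.  HONEST FRAMING: a reduction; (A), (B),
(R3), (R4), `SelmerComplement` are displayed hypotheses; no case of BSD.
[cite: MilneADT2006, Ch. I, Thm. 4.10 (a) (proof, p. 58), Thm. 2.13 (a), Lemma 4.13, Lemma 4.8]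
[cite: CasselsFrohlichANT1967, Ch. VII §9.6, §10, §11.1][cite: Harari2020, Thm. 17.13 (b)] -/
theorem poitouTate_sha_tateDual_of_localGlobal_real
    (hcomp : ∀ (n : ℕ) [NeZero n], (LocalInvariants.canonical K n).SelmerComplement)
    (inv : Abelian.Ext (triv (Γ := absoluteGaloisGroup K) ℤ) (classBarD K) 2 →+ AddCircle (1 : ℚ))
    (hT : TateDualityHypotheses (classBarD K) inv) (π : ∀ v : Place K, IdeleProjection K v)
    (hR3 : ∀ (n : ℕ) [NeZero n],
      ∀ ⦃M : Type⦄ [AddCommGroup M] [TopologicalSpace M] [DiscreteTopology M] [Finite M] [Finite (TateDual K M n)]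
      (ρ₀ : DiscreteGaloisModule K M) (hM : ∀ m : M, n • m = 0),
      ∀ T : Finset (Place K), (∀ w : InfinitePlace K, (Sum.inl w : Place K) ∈ T) →
        (∀ v : HeightOneSpectrum (𝓞 K), (Sum.inr v : Place K) ∉ T →
          ((n : ℕ) : 𝓞 K) ∉ v.asIdeal ∧ GaloisRep.IsUnramifiedAt v (ρ₀.tateDual n)) →
        ∀ t : Π v : Place K, galoisCohomology ((ρ₀.tateDual n).toLocal v) 1,
          (∀ v : HeightOneSpectrum (𝓞 K), (Sum.inr v : Place K) ∉ T →
            t (Sum.inr v) ∈ unramifiedSubgroup (GaloisRep.toLocal v (ρ₀.tateDual n)) 1) →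
          ∃ f : (presentationComplex ρ₀).X₁ ⟶ (ideleClassLimitShortComplex K).X₂,
            ∀ v : Place K, readout ρ₀ n hM (π v) f = t v)
    (hR4 : ∀ (n : ℕ) [NeZero n],
      ∀ ⦃M : Type⦄ [AddCommGroup M] [TopologicalSpace M] [DiscreteTopology M] [Finite M] [Finite (TateDual K M n)]
      (ρ₀ : DiscreteGaloisModule K M) (hM : ∀ m : M, n • m = 0),
      ∃ nat : galoisCohomology ((ρ₀.tateDual n).tateDual n) 1 →+
          Abelian.Ext (triv (Γ := absoluteGaloisGroup K) ℤ) (presentationComplex ρ₀).X₃ 1,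
        Function.Bijective nat ∧
        ∀ f : (presentationComplex ρ₀).X₁ ⟶ (ideleClassLimitShortComplex K).X₂, ∃ Tf : Finset (Place K),
          ∀ (y : galoisCohomology ((ρ₀.tateDual n).tateDual n) 1) (T' : Finset (Place K)), Tf ⊆ T' →
            (∀ v : HeightOneSpectrum (𝓞 K), (Sum.inr v : Place K) ∉ T' →
              galoisCohomology.localization ((ρ₀.tateDual n).tateDual n) (Sum.inr v) 1 y ∈
                unramifiedSubgroup (GaloisRep.toLocal v ((ρ₀.tateDual n).tateDual n)) 1) →
            zmodToQmodZ n (∑ v ∈ T', localTatePairingZMod (ρ₀.tateDual n) n v (LocalInvariants.canonical K n v)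
              (readout ρ₀ n hM (π v) f)
              (galoisCohomology.localization ((ρ₀.tateDual n).tateDual n) v 1 y)) =
            inv ((nat y).comp (boundary (presentationComplex_shortExact ρ₀) (classBarD K)
              (f ≫ (ideleClassLimitShortComplex K).g)) (rfl : 1 + 1 = 2)))
    (hA : ∀ (n : ℕ) [NeZero n],
      ∀ ⦃M : Type⦄ [AddCommGroup M] [TopologicalSpace M] [DiscreteTopology M] [Finite M]
      (ρ₀ : DiscreteGaloisModule K M) (hM : ∀ m : M, n • m = 0),
        haveI := moduleFinite_presModule₂ ρ₀
        ∀ c ∈ shaTwo (ρ₀.tateDual n),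
          cohomologyMap (dualF (presModule₂ ρ₀) ρ₀ (units K) (presProj ρ₀)) 2
            (cohomologyMap (HomDual.tateDualUnitsIso K ρ₀ n hM).hom 2 c) = 0)
    (hB : ∀ (n : ℕ) [NeZero n],
      ∀ ⦃M : Type⦄ [AddCommGroup M] [TopologicalSpace M] [DiscreteTopology M] [Finite M]
      (ρ₀ : DiscreteGaloisModule K M),
        haveI := moduleFinite_presModule₁ ρ₀
        ∀ y : galoisCohomology (homGaloisModule (presModule₁ ρ₀) (units K)) 1,
          (∀ v : Place K, ContinuousCohomology.map (absGaloisRestrict K (Place.Completion v))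
            (postcompResHom (presModule₁ ρ₀) (units K) (units (Place.Completion v)) (unitsTransfer K (Place.Completion v))) 1
              y = 0) →
          cohomologyMap (homF (presModule₁ ρ₀) (units K) (toDGM (ideleBarD K)) (unitsToIdeleI K)) 1 y = 0) :
    poitouTate_sha_tateDual K :=
  poitouTate_sha_tateDual_of_shaTwoConnecting_real hcomp inv hT π hR3 hR4 fun n _ _ _ _ _ _ ρ₀ hM c hc =>
    exists_shaTwoConnecting_eq_of_localGlobal ρ₀ n hM (hA n ρ₀ hM) (hB n ρ₀) c hc

end LocalGlobal

end Literature.NumberTheory.GaloisCohomology.PoitouTateFinite.PoitouTateShaTwoReadout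

end Part2

/-!
## Part 3 — port of `Summits/BirchSwinnertonDyer/BirchSwinnertonDyer/Theorems/SchneiderFreeAdditiveX3PoitouTateReciprocityCanonical.lean` (3 declarations kept)

# The presentation road at the CANONICAL level: Milne I Thm. 4.10 (b) `Ker γ¹ ⊆ Im β¹` for THE invariant maps `LocalInvariants.canonical K n` (every admissible `S`, every finite `n`-torsion `M`) from the sign-free E-side reciprocity sum; henc

Declarations of this Part (verbatim port; each keeps its own docstring and citation): `middleExact_canonical_of_reciprocitySum'`, `middleExact_canonical_of_reciprocitySum`, `selmerComplement_canonical_of_reciprocitySum`.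

Reference keys (see `references.bib` and the declarations' citations): [MilneADT2006], [CasselsFrohlichANT1967], [Howard2004HeegnerKolyvagin].
-/

section Part3

open _root_.Function _root_.NumberField _root_.IsDedekindDomain _root_.CategoryTheory CategoryTheory.Abelian
open scoped _root_.NumberField ContRepresentation

namespace Literature.NumberTheory.GaloisCohomology.PoitouTateFinite.PoitouTateReduction

open _root_.Field
open Literature.NumberTheory.GaloisRepresentations Literature.NumberTheory.GaloisCohomology
open Literature.NumberTheory.GaloisRepresentations.DiscreteGaloisModule (mu TateDual tateDual
  localTatePairingZMod unramifiedSubgroup)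
open Literature.Algebra.Homology Literature.Algebra.Homology.DiscreteRep Literature.Algebra.Homology.ExtPresentation
open Literature.NumberTheory.GaloisRepresentations.IdeleClassBar (classBarD classBarInv tateDualityHypotheses_classBarD_classBarInv)
open Literature.NumberTheory.GaloisRepresentations.FreePresentation (presentationComplex presentationComplex_shortExact
  presModule₁ presModule₂ presIncl presProj pres_isSES moduleFinite_presModule₁ moduleFinite_presModule₂)
open Literature.NumberTheory.GaloisRepresentations.HomDual (IdeleProjection readout readoutInvariant localReadout
  readout_eq_localReadout charZero_of_algebra equivariantMap restrictIntertwining isSES_restrict)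
open Literature.NumberTheory.GaloisRepresentations.DGMBridge (LCarrier)
open Literature.AnabelianGeometry.AbsoluteAnabelian.Prop121vii (zmodToQmodZ brauerInvariantEquiv)

variable {K : Type} [Field K] [NumberField K]
variable (inv : Abelian.Ext (triv (Γ := absoluteGaloisGroup K) ℤ) (classBarD K) 2 →+ AddCircle (1 : ℚ))

/-- **Milne I Thm. 4.10 (b), `r = 1`, `Ker γ¹ ⊆ Im β¹` for THE canonical invariant maps — at every level `n`, every admissible
finite set of places `S ⊇ {v ∣ ∞}` and every finite `n`-torsion `M` — from Tate duality for `(Γ_K, C̄, inv)` and the SIGN-FREE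
E-side reciprocity sum for THE idèle projections**  := door-c5's `ideleAssembly` through `exists_readout_eq_of_assembly` and (R4) := `hR4_of_globalTerms_of_imp`, then the
all-places ⟹ every-`S` reduction `middleExact_canonical_of_allPlaces_tateDual`).  This is the `hE` input of
`poitouTate_selmerStructure_duality_of_middleExact_canonical`, i.e. the canonical-level content behind door-c5's
`poitouTate_selmerStructure_duality_of_reciprocitySum'`.
[cite: MilneADT2006, Ch. I, Thm. 4.10 (b) (proof, p. 58), Lemma 4.13, Thm. 1.8][cite: CasselsFrohlichANT1967, Ch. VII §11.2 (bis)] -/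
theorem middleExact_canonical_of_reciprocitySum' (hT : TateDualityHypotheses (classBarD K) inv)
    (hE : ∀ (n : ℕ) [NeZero n],
      ∀ ⦃M : Type⦄ [AddCommGroup M] [TopologicalSpace M] [DiscreteTopology M] [Finite M] [Finite (TateDual K M n)]
      (ρ₀ : DiscreteGaloisModule K M) (hM : ∀ m : M, n • m = 0)
      (ι : ρ₀.toContRepresentation →ⁱL ((ρ₀.tateDual n).tateDual n).toContRepresentation),
      (∀ (m : M) (f : TateDual K M n), ι m f = f m) →
      ∀ (f : (presentationComplex ρ₀).X₁ ⟶ (ideleClassLimitShortComplex K).X₂)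
        (ŷ : Abelian.Ext (triv (Γ := absoluteGaloisGroup K) ℤ) (presentationComplex ρ₀).X₃ 1) (T₀ : Finset (Place K)),
        ∃ (x : galoisCohomology ρ₀ 1) (Tx : Finset (Place K)), T₀ ⊆ Tx ∧
          (∀ v : HeightOneSpectrum (𝓞 K), (Sum.inr v : Place K) ∉ Tx →
            galoisCohomology.localization ρ₀ (Sum.inr v) 1 x ∈ unramifiedSubgroup (GaloisRep.toLocal v ρ₀) 1) ∧
          ∀ T' : Finset (Place K), Tx ⊆ T' →
            (∑ v ∈ T', Sum.elim
              (fun w : InfinitePlace K => zmodToQmodZ n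
                (localTatePairingZMod (ρ₀.tateDual n) n (Sum.inl w) (LocalInvariants.canonical K n (Sum.inl w))
                  (readout ρ₀ n hM (IdeleReadout.ideleProjection K (Sum.inl w)) f)
                  (galoisCohomology.localization ((ρ₀.tateDual n).tateDual n) (Sum.inl w) 1
                    (galoisCohomology.map ι 1 x))))
              (fun v : HeightOneSpectrum (𝓞 K) =>
                haveI := moduleFinite_presModule₁ ρ₀
                haveI : CharZero (v.adicCompletion K) := charZero_of_algebra (K := K) (v.adicCompletion K);
                - brauerInvariantEquiv (v.adicCompletion K)
                  (cohomologyMap (toTopRepHom ((presModule₁ ρ₀).restrictField (v.adicCompletion K))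
                      (DiscreteGaloisModule.units (v.adicCompletion K))
                      (equivariantMap ((presModule₁ ρ₀).restrictField (v.adicCompletion K))
                        (DiscreteGaloisModule.units (v.adicCompletion K))
                        (readoutInvariant (IdeleReadout.ideleProjection K (Sum.inr v)) (presentationComplex ρ₀).X₁ f))) 2
                    (galoisCohomology.res (presModule₁ ρ₀) (v.adicCompletion K) 2 ((pres_isSES ρ₀).δ₁ x))))
              v) = 0 →
            inv (ŷ.comp (boundary (presentationComplex_shortExact ρ₀) (classBarD K)
              (f ≫ (ideleClassLimitShortComplex K).g)) (rfl : 1 + 1 = 2)) = 0) :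
    ∀ (n : ℕ) [NeZero n],
      ∀ ⦃M : Type⦄ [AddCommGroup M] [TopologicalSpace M] [DiscreteTopology M] [Finite M]
      (ρ : DiscreteGaloisModule K M), (∀ m : M, n • m = 0) →
      ∀ S : Finset (Place K), (∀ w : InfinitePlace K, (Sum.inl w : Place K) ∈ S) →
        (∀ v : HeightOneSpectrum (𝓞 K), (Sum.inr v : Place K) ∉ S →
          ((n : ℕ) : 𝓞 K) ∉ v.asIdeal ∧ GaloisRep.IsUnramifiedAt v ρ) →
        ∀ t : Π v : Place K, galoisCohomology (ρ.toLocal v) 1,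
          (∀ y : galoisCohomology (ρ.tateDual n) 1,
            (∀ v : HeightOneSpectrum (𝓞 K), (Sum.inr v : Place K) ∉ S →
              galoisCohomology.localization (ρ.tateDual n) (Sum.inr v) 1 y ∈
                unramifiedSubgroup (GaloisRep.toLocal v (ρ.tateDual n)) 1) →
            ∑ v ∈ S, localTatePairingZMod ρ n v (LocalInvariants.canonical K n v) (t v)
              (galoisCohomology.localization (ρ.tateDual n) v 1 y) = 0) →
          ∃ x : galoisCohomology ρ 1,
            (∀ v : HeightOneSpectrum (𝓞 K), (Sum.inr v : Place K) ∉ S →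
              galoisCohomology.localization ρ (Sum.inr v) 1 x ∈
                unramifiedSubgroup (GaloisRep.toLocal v ρ) 1) ∧
            ∀ v ∈ S, galoisCohomology.localization ρ v 1 x = t v := by
  intro n _ M _ _ _ _ ρ hM S hinf hS t horth
  haveI := DiscreteGaloisModule.TateDual.finite K M n
  refine middleExact_canonical_of_allPlaces_tateDual ρ hM ?_ hinf hS t horth
  obtain ⟨ι, κ, hι, hκι, hικ⟩ := exists_bidual_intertwining (n := n) ρ hM
  have hκ : ∀ (Φ : TateDual K (TateDual K M n) n) (g : TateDual K M n), Φ g = g (κ Φ) := fun Φ g => by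
    conv_lhs => rw [← hικ Φ]
    exact hι (κ Φ) g
  exact middleExact_allPlaces_tateDual_of_ideleProjection inv hT (IdeleReadout.ideleProjection K) ρ hM
    (exists_readout_eq_of_assembly (IdeleReadout.ideleProjection K) ρ hM (IdeleReadout.ideleAssembly (K := K) n ρ hM))
    (hR4_of_globalTerms_of_imp inv (IdeleReadout.ideleProjection K) ρ hM ι κ hκι hκ (hE n ρ hM ι hι))

/-- **The same for `inv := classBarInv K`** .
[cite: MilneADT2006, Ch. I, Thm. 4.10 (b) (proof, p. 58), Thm. 1.8][cite: CasselsFrohlichANT1967, Ch. VII §11.2 (bis)] -/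
theorem middleExact_canonical_of_reciprocitySum
    (hE : ∀ (n : ℕ) [NeZero n],
      ∀ ⦃M : Type⦄ [AddCommGroup M] [TopologicalSpace M] [DiscreteTopology M] [Finite M] [Finite (TateDual K M n)]
      (ρ₀ : DiscreteGaloisModule K M) (hM : ∀ m : M, n • m = 0)
      (ι : ρ₀.toContRepresentation →ⁱL ((ρ₀.tateDual n).tateDual n).toContRepresentation),
      (∀ (m : M) (f : TateDual K M n), ι m f = f m) →
      ∀ (f : (presentationComplex ρ₀).X₁ ⟶ (ideleClassLimitShortComplex K).X₂)
        (ŷ : Abelian.Ext (triv (Γ := absoluteGaloisGroup K) ℤ) (presentationComplex ρ₀).X₃ 1) (T₀ : Finset (Place K)),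
        ∃ (x : galoisCohomology ρ₀ 1) (Tx : Finset (Place K)), T₀ ⊆ Tx ∧
          (∀ v : HeightOneSpectrum (𝓞 K), (Sum.inr v : Place K) ∉ Tx →
            galoisCohomology.localization ρ₀ (Sum.inr v) 1 x ∈ unramifiedSubgroup (GaloisRep.toLocal v ρ₀) 1) ∧
          ∀ T' : Finset (Place K), Tx ⊆ T' →
            (∑ v ∈ T', Sum.elim
              (fun w : InfinitePlace K => zmodToQmodZ n
                (localTatePairingZMod (ρ₀.tateDual n) n (Sum.inl w) (LocalInvariants.canonical K n (Sum.inl w))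
                  (readout ρ₀ n hM (IdeleReadout.ideleProjection K (Sum.inl w)) f)
                  (galoisCohomology.localization ((ρ₀.tateDual n).tateDual n) (Sum.inl w) 1
                    (galoisCohomology.map ι 1 x))))
              (fun v : HeightOneSpectrum (𝓞 K) =>
                haveI := moduleFinite_presModule₁ ρ₀
                haveI : CharZero (v.adicCompletion K) := charZero_of_algebra (K := K) (v.adicCompletion K);
                - brauerInvariantEquiv (v.adicCompletion K)
                  (cohomologyMap (toTopRepHom ((presModule₁ ρ₀).restrictField (v.adicCompletion K))
                      (DiscreteGaloisModule.units (v.adicCompletion K))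
                      (equivariantMap ((presModule₁ ρ₀).restrictField (v.adicCompletion K))
                        (DiscreteGaloisModule.units (v.adicCompletion K))
                        (readoutInvariant (IdeleReadout.ideleProjection K (Sum.inr v)) (presentationComplex ρ₀).X₁ f))) 2
                    (galoisCohomology.res (presModule₁ ρ₀) (v.adicCompletion K) 2 ((pres_isSES ρ₀).δ₁ x))))
              v) = 0 →
            classBarInv K (ŷ.comp (boundary (presentationComplex_shortExact ρ₀) (classBarD K)
              (f ≫ (ideleClassLimitShortComplex K).g)) (rfl : 1 + 1 = 2)) = 0) :
    ∀ (n : ℕ) [NeZero n],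
      ∀ ⦃M : Type⦄ [AddCommGroup M] [TopologicalSpace M] [DiscreteTopology M] [Finite M]
      (ρ : DiscreteGaloisModule K M), (∀ m : M, n • m = 0) →
      ∀ S : Finset (Place K), (∀ w : InfinitePlace K, (Sum.inl w : Place K) ∈ S) →
        (∀ v : HeightOneSpectrum (𝓞 K), (Sum.inr v : Place K) ∉ S →
          ((n : ℕ) : 𝓞 K) ∉ v.asIdeal ∧ GaloisRep.IsUnramifiedAt v ρ) →
        ∀ t : Π v : Place K, galoisCohomology (ρ.toLocal v) 1,
          (∀ y : galoisCohomology (ρ.tateDual n) 1,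
            (∀ v : HeightOneSpectrum (𝓞 K), (Sum.inr v : Place K) ∉ S →
              galoisCohomology.localization (ρ.tateDual n) (Sum.inr v) 1 y ∈
                unramifiedSubgroup (GaloisRep.toLocal v (ρ.tateDual n)) 1) →
            ∑ v ∈ S, localTatePairingZMod ρ n v (LocalInvariants.canonical K n v) (t v)
              (galoisCohomology.localization (ρ.tateDual n) v 1 y) = 0) →
          ∃ x : galoisCohomology ρ 1,
            (∀ v : HeightOneSpectrum (𝓞 K), (Sum.inr v : Place K) ∉ S →
              galoisCohomology.localization ρ (Sum.inr v) 1 x ∈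
                unramifiedSubgroup (GaloisRep.toLocal v ρ) 1) ∧
            ∀ v ∈ S, galoisCohomology.localization ρ v 1 x = t v :=
  middleExact_canonical_of_reciprocitySum' (classBarInv K) (tateDualityHypotheses_classBarD_classBarInv K) hE

/-- **`SelmerComplement` OF THE CANONICAL FAMILY at every level from the sign-free reciprocity sum** — the input `hcomp` of the
`Ш²`-readout road to `poitouTate_sha_tateDual` (bsd-wall chl-p2 / door-c5 g18).
[cite: MilneADT2006, Ch. I, Thm. 4.10 (b)][cite: Howard2004HeegnerKolyvagin, Thm. 2.1.11 (arXiv:1202.6340 p. 6)] -/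
theorem selmerComplement_canonical_of_reciprocitySum
    (hE : ∀ (n : ℕ) [NeZero n],
      ∀ ⦃M : Type⦄ [AddCommGroup M] [TopologicalSpace M] [DiscreteTopology M] [Finite M] [Finite (TateDual K M n)]
      (ρ₀ : DiscreteGaloisModule K M) (hM : ∀ m : M, n • m = 0)
      (ι : ρ₀.toContRepresentation →ⁱL ((ρ₀.tateDual n).tateDual n).toContRepresentation),
      (∀ (m : M) (f : TateDual K M n), ι m f = f m) →
      ∀ (f : (presentationComplex ρ₀).X₁ ⟶ (ideleClassLimitShortComplex K).X₂)
        (ŷ : Abelian.Ext (triv (Γ := absoluteGaloisGroup K) ℤ) (presentationComplex ρ₀).X₃ 1) (T₀ : Finset (Place K)),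
        ∃ (x : galoisCohomology ρ₀ 1) (Tx : Finset (Place K)), T₀ ⊆ Tx ∧
          (∀ v : HeightOneSpectrum (𝓞 K), (Sum.inr v : Place K) ∉ Tx →
            galoisCohomology.localization ρ₀ (Sum.inr v) 1 x ∈ unramifiedSubgroup (GaloisRep.toLocal v ρ₀) 1) ∧
          ∀ T' : Finset (Place K), Tx ⊆ T' →
            (∑ v ∈ T', Sum.elim
              (fun w : InfinitePlace K => zmodToQmodZ n
                (localTatePairingZMod (ρ₀.tateDual n) n (Sum.inl w) (LocalInvariants.canonical K n (Sum.inl w))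
                  (readout ρ₀ n hM (IdeleReadout.ideleProjection K (Sum.inl w)) f)
                  (galoisCohomology.localization ((ρ₀.tateDual n).tateDual n) (Sum.inl w) 1
                    (galoisCohomology.map ι 1 x))))
              (fun v : HeightOneSpectrum (𝓞 K) =>
                haveI := moduleFinite_presModule₁ ρ₀
                haveI : CharZero (v.adicCompletion K) := charZero_of_algebra (K := K) (v.adicCompletion K);
                - brauerInvariantEquiv (v.adicCompletion K)
                  (cohomologyMap (toTopRepHom ((presModule₁ ρ₀).restrictField (v.adicCompletion K))
                      (DiscreteGaloisModule.units (v.adicCompletion K))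
                      (equivariantMap ((presModule₁ ρ₀).restrictField (v.adicCompletion K))
                        (DiscreteGaloisModule.units (v.adicCompletion K))
                        (readoutInvariant (IdeleReadout.ideleProjection K (Sum.inr v)) (presentationComplex ρ₀).X₁ f))) 2
                    (galoisCohomology.res (presModule₁ ρ₀) (v.adicCompletion K) 2 ((pres_isSES ρ₀).δ₁ x))))
              v) = 0 →
            classBarInv K (ŷ.comp (boundary (presentationComplex_shortExact ρ₀) (classBarD K)
              (f ≫ (ideleClassLimitShortComplex K).g)) (rfl : 1 + 1 = 2)) = 0)
    (n : ℕ) [NeZero n] : (LocalInvariants.canonical K n).SelmerComplement :=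
  selmerComplement_canonical_of_middleExact_allLevels n (middleExact_canonical_of_reciprocitySum hE n)

end Literature.NumberTheory.GaloisCohomology.PoitouTateFinite.PoitouTateReduction

end Part3

/-!
## Part 4 — port of `Summits/BirchSwinnertonDyer/BirchSwinnertonDyer/Theorems/SchneiderFreeAdditiveX3PoitouTateReciprocitySumHolds.lean` (1 declarations kept)

# The SIGN-FREE E-side reciprocity sum HOLDS for every number field; `poitouTate_selmerStructure_duality_real K` and `(LocalInvariants.canonical K n).SelmerComplement` for every `K`, `n`

Declarations of this Part (verbatim port; each keeps its own docstring and citation): `selmerComplement_canonical_holds`.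

Reference keys (see `references.bib` and the declarations' citations): [MilneADT2006], [Howard2004HeegnerKolyvagin].
-/

section Part4

open _root_.Function _root_.NumberField _root_.IsDedekindDomain _root_.CategoryTheory CategoryTheory.Abelian groupCohomology
open scoped _root_.NumberField ContRepresentation

set_option autoImplicit false

namespace Literature.NumberTheory.GaloisCohomology.PoitouTateFinite.PoitouTateReduction

open _root_.Field
open Literature.NumberTheory.GaloisRepresentations Literature.NumberTheory.GaloisCohomology
open Literature.NumberTheory.GaloisRepresentations.DiscreteGaloisModule (mu TateDual tateDual localTatePairingZMod
  localTatePairingZMod_apply unramifiedSubgroup)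
open Literature.Algebra.Homology Literature.Algebra.Homology.DiscreteRep Literature.Algebra.Homology.ExtPresentation
open Literature.NumberTheory.GaloisRepresentations.IdeleClassBar (classBarD classBarInv GalLayer)
open Literature.NumberTheory.GaloisRepresentations.FreePresentation
open Literature.NumberTheory.GaloisRepresentations.HomDual (IdeleProjection readout readoutInvariant localReadout
  readout_eq_localReadout charZero_of_algebra equivariantMap restrictIntertwining isSES_restrict)
open Literature.NumberTheory.GaloisRepresentations.DGMBridge (LCarrier)
open Literature.NumberTheory.GaloisRepresentations.IdeleReadout (ideleProjection layerEmb)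
open Literature.NumberTheory.Automorphic (IdeleClassGroup.ideleRep)
open Literature.AnabelianGeometry.AbsoluteAnabelian.Prop121vii (zmodToQmodZ brauerInvariantEquiv)

variable (K : Type) [Field K] [NumberField K]

/-- **`SelmerComplement` OF THE CANONICAL FAMILY HOLDS at every level**, for every number field — the input `hcomp` of the
`Ш²`-readout road to `poitouTate_sha_tateDual`.
[cite: MilneADT2006, Ch. I, Thm. 4.10 (b)][cite: Howard2004HeegnerKolyvagin, Thm. 2.1.11 (arXiv:1202.6340 p. 6)] -/
theorem selmerComplement_canonical_holds (n : ℕ) [NeZero n] : (LocalInvariants.canonical K n).SelmerComplement :=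
  selmerComplement_canonical_of_reciprocitySum (reciprocitySum_holds K) n

end Literature.NumberTheory.GaloisCohomology.PoitouTateFinite.PoitouTateReduction

end Part4

/-!
## Part 5 — port of `Summits/BirchSwinnertonDyer/BirchSwinnertonDyer/Theorems/ThetaPartnerAtTwoSignedControlAtTwoShaTwoOfBridgeOfLocalGlobal.lean` (2 declarations kept)

# `poitouTate_sha_tateDual K` for EVERY number field — from TWO displayed bricks beyond `SelmerComplement`: the bridge (nat, R4=) and the local–global principle (A); idèle projections, (R3), Tate

Declarations of this Part (verbatim port; each keeps its own docstring and citation): `poitouTate_sha_tateDual_of_bridge_of_localGlobal`, `poitouTate_sha_tateDual_of_bridge_of_localGlobal'`.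

Reference keys (see `references.bib` and the declarations' citations): [MilneADT2006], [CasselsFrohlichANT1967], [Harari2020].
-/

section Part5

open _root_.Function _root_.NumberField _root_.IsDedekindDomain _root_.CategoryTheory CategoryTheory.Abelian
open scoped _root_.NumberField ContRepresentation

set_option autoImplicit false

namespace Literature.NumberTheory.GaloisCohomology.PoitouTateFinite.PoitouTateShaTwoReadout

open _root_.Field
open Literature.NumberTheory.GaloisRepresentations Literature.NumberTheory.GaloisCohomology
open Literature.NumberTheory.GaloisRepresentations.DiscreteGaloisModule (TateDual tateDual localTatePairingZMod
  unramifiedSubgroup sha shaTwo)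
open Literature.Algebra.Homology Literature.Algebra.Homology.DiscreteRep Literature.Algebra.Homology.ExtPresentation
open Literature.NumberTheory.GaloisRepresentations.IdeleClassBar (classBarD classBarInv tateDualityHypotheses_classBarD_classBarInv)
open Literature.AnabelianGeometry.AbsoluteAnabelian.Prop121vii (zmodToQmodZ)
open Literature.NumberTheory.GaloisRepresentations.FreePresentation (presentationComplex presentationComplex_shortExact
  presModule₁ presModule₂ presProj moduleFinite_presModule₁ moduleFinite_presModule₂)
open Literature.NumberTheory.GaloisRepresentations.HomDual (readout dualF)
open Literature.NumberTheory.GaloisRepresentations.DiscreteGaloisModule (units)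
open Literature.NumberTheory.GaloisCohomology.PoitouTateFinite.PoitouTateReduction
  (exists_readout_eq_of_assembly)

section AnyField

variable {K : Type} [Field K] [NumberField K]

/-- **`poitouTate_sha_tateDual K` for ANY number field from the bridge (nat, R4=) and the local–global principle (A)** — with
`inv := classBarInv K` , `π := ideleProjection K`
, (R3) discharged by door-c5's idèle assembly through door-c6's `exists_readout_eq_of_assembly`, and (B) discharged by
door-c5's `IdeleReadout.sha_hom_units_dies_in_idele`.  Displayed: `SelmerComplement` of the canonical invariant maps at every
level (= `hE(n)`), the bridge `nat : H¹(K, M₀^{DD}) ≅ Ext¹(ℤ, M₀)` with the (R4) identity in EQUALITY form for THE idèle readout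
(archimedean summands included), and (A) (for `c ∈ Ш²(K, M₀^D)` the class `H²(p^*)(H²(e) c) ∈ H²(K, Hom_ℤ(P, K̄ˣ))` vanishes).
[cite: MilneADT2006, Ch. I, Thm. 4.10 (a) (proof, p. 58), Lemma 4.13, Thm. 1.8][cite: CasselsFrohlichANT1967, Ch. VII §11.2 (bis)]
[cite: Harari2020, Thm. 17.13 (b)] -/
theorem poitouTate_sha_tateDual_of_bridge_of_localGlobal
    (hcomp : ∀ (n : ℕ) [NeZero n], (LocalInvariants.canonical K n).SelmerComplement)
    (hR4 : ∀ (n : ℕ) [NeZero n],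
      ∀ ⦃M : Type⦄ [AddCommGroup M] [TopologicalSpace M] [DiscreteTopology M] [Finite M] [Finite (TateDual K M n)]
      (ρ₀ : DiscreteGaloisModule K M) (hM : ∀ m : M, n • m = 0),
      ∃ nat : galoisCohomology ((ρ₀.tateDual n).tateDual n) 1 →+
          Abelian.Ext (triv (Γ := absoluteGaloisGroup K) ℤ) (presentationComplex ρ₀).X₃ 1,
        Function.Bijective nat ∧
        ∀ f : (presentationComplex ρ₀).X₁ ⟶ (ideleClassLimitShortComplex K).X₂, ∃ Tf : Finset (Place K),
          ∀ (y : galoisCohomology ((ρ₀.tateDual n).tateDual n) 1) (T' : Finset (Place K)), Tf ⊆ T' →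
            (∀ v : HeightOneSpectrum (𝓞 K), (Sum.inr v : Place K) ∉ T' →
              galoisCohomology.localization ((ρ₀.tateDual n).tateDual n) (Sum.inr v) 1 y ∈
                unramifiedSubgroup (GaloisRep.toLocal v ((ρ₀.tateDual n).tateDual n)) 1) →
            zmodToQmodZ n (∑ v ∈ T', localTatePairingZMod (ρ₀.tateDual n) n v (LocalInvariants.canonical K n v)
              (readout ρ₀ n hM (IdeleReadout.ideleProjection K v) f)
              (galoisCohomology.localization ((ρ₀.tateDual n).tateDual n) v 1 y)) =
            classBarInv K ((nat y).comp (boundary (presentationComplex_shortExact ρ₀) (classBarD K)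
              (f ≫ (ideleClassLimitShortComplex K).g)) (rfl : 1 + 1 = 2)))
    (hA : ∀ (n : ℕ) [NeZero n],
      ∀ ⦃M : Type⦄ [AddCommGroup M] [TopologicalSpace M] [DiscreteTopology M] [Finite M]
      (ρ₀ : DiscreteGaloisModule K M) (hM : ∀ m : M, n • m = 0),
        haveI := moduleFinite_presModule₂ ρ₀
        ∀ c ∈ shaTwo (ρ₀.tateDual n),
          cohomologyMap (dualF (presModule₂ ρ₀) ρ₀ (units K) (presProj ρ₀)) 2
            (cohomologyMap (HomDual.tateDualUnitsIso K ρ₀ n hM).hom 2 c) = 0) :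
    poitouTate_sha_tateDual K :=
  poitouTate_sha_tateDual_of_localGlobal_real hcomp (classBarInv K) (tateDualityHypotheses_classBarD_classBarInv K)
    (IdeleReadout.ideleProjection K)
    (fun n _ _ _ _ _ _ _ ρ₀ hM => exists_readout_eq_of_assembly (IdeleReadout.ideleProjection K) ρ₀ hM
      (IdeleReadout.ideleAssembly (K := K) n ρ₀ hM))
    hR4 hA (fun _ _ _ _ _ _ _ ρ₀ => IdeleReadout.sha_hom_units_dies_in_idele ρ₀)

end AnyField

end Literature.NumberTheory.GaloisCohomology.PoitouTateFinite.PoitouTateShaTwoReadout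

namespace Literature.NumberTheory.GaloisCohomology.PoitouTateFinite.PoitouTateShaTwoReadout

open _root_.Field
open Literature.NumberTheory.GaloisRepresentations Literature.NumberTheory.GaloisCohomology
open Literature.NumberTheory.GaloisRepresentations.DiscreteGaloisModule (TateDual tateDual localTatePairingZMod
  unramifiedSubgroup sha shaTwo units)
open Literature.Algebra.Homology Literature.Algebra.Homology.DiscreteRep Literature.Algebra.Homology.ExtPresentation
open Literature.NumberTheory.GaloisRepresentations.IdeleClassBar (classBarD classBarInv)
open Literature.AnabelianGeometry.AbsoluteAnabelian.Prop121vii (zmodToQmodZ)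
open Literature.NumberTheory.GaloisRepresentations.FreePresentation (presentationComplex presentationComplex_shortExact
  presModule₂ presProj moduleFinite_presModule₂)
open Literature.NumberTheory.GaloisRepresentations.HomDual (readout dualF)
open Literature.NumberTheory.GaloisCohomology.PoitouTateFinite.PoitouTateReduction
  (selmerComplement_canonical_holds)

section Discharged

variable {K : Type} [Field K] [NumberField K]

/-- **`poitouTate_sha_tateDual K` (Milne I Thm. 4.10 (a), all finite modules) for ANY number field from TWO displayed bricks**:
the bridge (nat, R4=) for THE idèle readout with `inv := classBarInv K` (archimedean summands included), and the local–global
principle (A) (Brauer–Hasse–Noether for `K(M₀)` + Shapiro in degree `2`, on `Ш²`-classes).  `SelmerComplement` of the canonical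
invariant maps at every level is now door-c4 g18's THEOREM `selmerComplement_canonical_holds K n`; (inv, hT), `π`, (R3), (B) as in
§1. [cite: MilneADT2006, Ch. I, Thm. 4.10 (a)(b) (proof, p. 58), Lemma 4.13][cite: Harari2020, Thm. 17.13 (b)] -/
theorem poitouTate_sha_tateDual_of_bridge_of_localGlobal'
    (hR4 : ∀ (n : ℕ) [NeZero n],
      ∀ ⦃M : Type⦄ [AddCommGroup M] [TopologicalSpace M] [DiscreteTopology M] [Finite M] [Finite (TateDual K M n)]
      (ρ₀ : DiscreteGaloisModule K M) (hM : ∀ m : M, n • m = 0),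
      ∃ nat : galoisCohomology ((ρ₀.tateDual n).tateDual n) 1 →+
          Abelian.Ext (triv (Γ := absoluteGaloisGroup K) ℤ) (presentationComplex ρ₀).X₃ 1,
        Function.Bijective nat ∧
        ∀ f : (presentationComplex ρ₀).X₁ ⟶ (ideleClassLimitShortComplex K).X₂, ∃ Tf : Finset (Place K),
          ∀ (y : galoisCohomology ((ρ₀.tateDual n).tateDual n) 1) (T' : Finset (Place K)), Tf ⊆ T' →
            (∀ v : HeightOneSpectrum (𝓞 K), (Sum.inr v : Place K) ∉ T' →
              galoisCohomology.localization ((ρ₀.tateDual n).tateDual n) (Sum.inr v) 1 y ∈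
                unramifiedSubgroup (GaloisRep.toLocal v ((ρ₀.tateDual n).tateDual n)) 1) →
            zmodToQmodZ n (∑ v ∈ T', localTatePairingZMod (ρ₀.tateDual n) n v (LocalInvariants.canonical K n v)
              (readout ρ₀ n hM (IdeleReadout.ideleProjection K v) f)
              (galoisCohomology.localization ((ρ₀.tateDual n).tateDual n) v 1 y)) =
            classBarInv K ((nat y).comp (boundary (presentationComplex_shortExact ρ₀) (classBarD K)
              (f ≫ (ideleClassLimitShortComplex K).g)) (rfl : 1 + 1 = 2)))
    (hA : ∀ (n : ℕ) [NeZero n],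
      ∀ ⦃M : Type⦄ [AddCommGroup M] [TopologicalSpace M] [DiscreteTopology M] [Finite M]
      (ρ₀ : DiscreteGaloisModule K M) (hM : ∀ m : M, n • m = 0),
        haveI := moduleFinite_presModule₂ ρ₀
        ∀ c ∈ shaTwo (ρ₀.tateDual n),
          cohomologyMap (dualF (presModule₂ ρ₀) ρ₀ (units K) (presProj ρ₀)) 2
            (cohomologyMap (HomDual.tateDualUnitsIso K ρ₀ n hM).hom 2 c) = 0) :
    poitouTate_sha_tateDual K :=
  poitouTate_sha_tateDual_of_bridge_of_localGlobal (fun n _ => selmerComplement_canonical_holds K n) hR4 hA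

end Discharged

end Literature.NumberTheory.GaloisCohomology.PoitouTateFinite.PoitouTateShaTwoReadout

end Part5

/-!
## Part 6 — port of `Summits/BirchSwinnertonDyer/BirchSwinnertonDyer/Theorems/SchneiderFreeAdditiveX3PoitouTateShaDualOfReadoutUnramified.lean` (1 declarations kept)

# PT (ii) `poitouTate_sha_tateDual K` at EVERY number field `K` from the bridge (nat, R4=) ALONE, and from the ONE named input `hRur` (local readouts of an idèle-valued map are unramified almost everywhere)

Declarations of this Part (verbatim port; each keeps its own docstring and citation): `poitouTate_sha_tateDual_of_R4`.

Reference keys (see `references.bib` and the declarations' citations): [MilneADT2006].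
-/

section Part6

open _root_.Function _root_.NumberField _root_.IsDedekindDomain _root_.CategoryTheory
open scoped _root_.NumberField ContRepresentation

namespace Literature.NumberTheory.GaloisCohomology.PoitouTateFinite.PoitouTateReduction

open _root_.Field
open Literature.NumberTheory.GaloisRepresentations Literature.NumberTheory.GaloisCohomology
open Literature.NumberTheory.GaloisRepresentations.DiscreteGaloisModule (TateDual tateDual units shaTwo unramifiedSubgroup
  localTatePairingZMod)
open Literature.Algebra.Homology Literature.Algebra.Homology.DiscreteRep Literature.Algebra.Homology.ExtPresentation
open Literature.NumberTheory.GaloisRepresentations.IdeleClassBar (classBarD classBarInv)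
open Literature.AnabelianGeometry.AbsoluteAnabelian.Prop121vii (zmodToQmodZ)
open Literature.NumberTheory.GaloisRepresentations.FreePresentation (presentationComplex presentationComplex_shortExact
  presModule₂ presProj moduleFinite_presModule₂)
open Literature.NumberTheory.GaloisRepresentations.HomDual (readout dualF tateDualUnitsIso)
open Literature.NumberTheory.GaloisRepresentations.IdeleReadout (ideleProjection)
open Literature.NumberTheory.GaloisRepresentations.OpenLayer (extOneEquiv)
open Literature.NumberTheory.GaloisCohomology.PoitouTateFinite.PoitouTateShaTwoReadout
  (poitouTate_sha_tateDual_of_bridge_of_localGlobal' tateDual_localGlobal_real)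

variable {K : Type} [Field K] [NumberField K]

/-- **PT (ii) at ANY number field `K` from the bridge (nat, R4=) ALONE**: hypothesis (A) of
`poitouTate_sha_tateDual_of_bridge_of_localGlobal'` is the theorem `tateDual_localGlobal_real` (no `IsTotallyComplex`).
CONDITIONAL on `hR4`; no case of BSD is proved. [cite: MilneADT2006, I Thm. 4.10 (a) (proof, p. 58)] -/
theorem poitouTate_sha_tateDual_of_R4
    (hR4 : ∀ (n : ℕ) [NeZero n],
      ∀ ⦃M : Type⦄ [AddCommGroup M] [TopologicalSpace M] [DiscreteTopology M] [Finite M] [Finite (TateDual K M n)]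
      (ρ₀ : DiscreteGaloisModule K M) (hM : ∀ m : M, n • m = 0),
      ∃ nat : galoisCohomology ((ρ₀.tateDual n).tateDual n) 1 →+
          Abelian.Ext (triv (Γ := absoluteGaloisGroup K) ℤ) (presentationComplex ρ₀).X₃ 1,
        Function.Bijective nat ∧
        ∀ f : (presentationComplex ρ₀).X₁ ⟶ (ideleClassLimitShortComplex K).X₂, ∃ Tf : Finset (Place K),
          ∀ (y : galoisCohomology ((ρ₀.tateDual n).tateDual n) 1) (T' : Finset (Place K)), Tf ⊆ T' →
            (∀ v : HeightOneSpectrum (𝓞 K), (Sum.inr v : Place K) ∉ T' →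
              galoisCohomology.localization ((ρ₀.tateDual n).tateDual n) (Sum.inr v) 1 y ∈
                unramifiedSubgroup (GaloisRep.toLocal v ((ρ₀.tateDual n).tateDual n)) 1) →
            zmodToQmodZ n (∑ v ∈ T', localTatePairingZMod (ρ₀.tateDual n) n v (LocalInvariants.canonical K n v)
              (readout ρ₀ n hM (ideleProjection K v) f)
              (galoisCohomology.localization ((ρ₀.tateDual n).tateDual n) v 1 y)) =
            classBarInv K ((nat y).comp (boundary (presentationComplex_shortExact ρ₀) (classBarD K)
              (f ≫ (ideleClassLimitShortComplex K).g)) (rfl : 1 + 1 = 2))) :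
    poitouTate_sha_tateDual K :=
  poitouTate_sha_tateDual_of_bridge_of_localGlobal' hR4 fun n _ _ _ _ _ _ ρ₀ hM => tateDual_localGlobal_real ρ₀ n hM

end Literature.NumberTheory.GaloisCohomology.PoitouTateFinite.PoitouTateReduction

end Part6

/-!
## Part 7 — port of `Summits/BirchSwinnertonDyer/BirchSwinnertonDyer/Theorems/SchneiderFreeAdditiveX3PoitouTateShaDualityHolds.lean` (1 declarations kept)

# Poitou–Tate duality of `Ш¹(K, M^D)` and `Ш²(K, M)` — the named fact `poitouTate_sha_tateDual K` — HOLDS for EVERY number field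

Declarations of this Part (verbatim port; each keeps its own docstring and citation): `poitouTate_sha_tateDual_holds`.

Reference keys (see `references.bib` and the declarations' citations): [MilneADT2006], [Harari2020], [Tate1963DualityICM].
-/

section Part7

namespace Literature.NumberTheory.GaloisCohomology.PoitouTateFinite.PoitouTateReduction

open Literature.NumberTheory.GaloisCohomology

/-- **Poitou–Tate duality (b) — `Ш¹(K, M^D)` and `Ш²(K, M)` are finite and perfectly paired — for EVERY number field `K` and
every finite Galois module**: the tree's named fact `poitouTate_sha_tateDual K` DISCHARGED (`poitouTate_sha_tateDual_of_R4` fed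
with door-c5 g18's bridge `hR4_ideleProjection`; every other input of Milne's proof is a tree theorem, see the module docstring).
A published theorem re-proved in the tree; not a case of BSD.
[cite: MilneADT2006, Ch. I, Thm. 4.10 (a) (proof, p. 58), Lemma 4.13][cite: Harari2020, Thm. 17.13 (b)][cite: Tate1963DualityICM, Thm. 3.1] -/
theorem _root_.Literature.NumberTheory.GaloisCohomology.poitouTate_sha_tateDual_holds (K : Type) [Field K] [NumberField K] : poitouTate_sha_tateDual K :=
  poitouTate_sha_tateDual_of_R4 (K := K) fun n _ _ _ _ _ _ _ ρ₀ hM => hR4_ideleProjection n ρ₀ hM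

end Literature.NumberTheory.GaloisCohomology.PoitouTateFinite.PoitouTateReduction

end Part7

/-!
## Part 8 — port of `Summits/BirchSwinnertonDyer/BirchSwinnertonDyer/Theorems/ThetaPartnerAtTwoSignedControlAtTwoGlobalHTwoFiniteSupport.lean` (3 declarations kept)

# A class of `H²(K, M)`, `M` FINITE, is locally zero at all but finitely many places (Milne ADT I Lemma 4.8 / Harari Prop. 17.6 with Lemma 17.8: "the image of `β²` lies in `⊕_v H²(K_v, M)`") — every number field, every finite discrete Galois

Declarations of this Part (verbatim port; each keeps its own docstring and citation): `eventually_localization_two_eq_zero`, `finite_setOf_localization_two_ne_zero`, `finite_setOf_localization_two_trivial_zmod_ne_zero`.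

Reference keys (see `references.bib` and the declarations' citations): [MilneADT2006], [Harari2020].
-/

section Part8

open scoped _root_.Classical

open _root_.CategoryTheory _root_.Field _root_.NumberField _root_.IsDedekindDomain _root_.Topology
open Literature.NumberTheory.EllipticCurves
open Literature.NumberTheory.GaloisRepresentations
open scoped ContRepresentation

universe u

namespace Literature.NumberTheory.GaloisCohomology.PoitouTateFinite.SignedEC.H2FiniteSupport

open Literature.NumberTheory.GaloisCohomology.PoitouTateFinite.H2Support

variable {K : Type u} [Field K] [NumberField K]
variable {M : Type u} [AddCommGroup M] [TopologicalSpace M] [DiscreteTopology M] [Finite M]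

/-- **A class of `H²(K, M)`, `M` a FINITE discrete `Γ_K`-module, is locally zero at all but finitely many finite places** (Milne I
Lemma 4.8 / Harari Prop. 17.6: the diagonal map `β² : H²(K, M) → ∏_v H²(K_v, M)` lands in `⊕_v H²(K_v, M)`).  The cocycle is
bi-invariant under an open normal subgroup `N ⊴ Γ_K` acting trivially on `M`; `N ⊇ Gal(K̄/E)` for a finite Galois `E`; at the
cofinitely many `v` whose inertia fixes `E` the restricted cocycle is bi-invariant under `res⁻¹(N) ⊇ I_{K_v}` acting trivially, hence
has trivial class (`H2Support.twoCocycleClass_eq_zero_of_biinvariant_of_absInertia_le`).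
[cite: MilneADT2006, Ch. I §4, Lemma 4.8] [cite: Harari2020, Prop. 17.6 and Lemma 17.8] -/
theorem eventually_localization_two_eq_zero (ρ : DiscreteGaloisModule K M) (x : galoisCohomology ρ 2) :
    ∀ᶠ v : HeightOneSpectrum (𝓞 K) in Filter.cofinite, galoisCohomology.localization ρ (Sum.inr v) 2 x = 0 := by
  classical
  -- `H²` on explicit cocycles needs `LocallyCompactSpace Γ`: compactness of absolute Galois groups is a tree theorem
  haveI : CompactSpace (absoluteGaloisGroup K) := absoluteGaloisGroup_compactSpace K
  obtain ⟨c, hc⟩ := twoCocycleClass_surjective _ x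
  -- uniform local constancy of the cocycle, and triviality of the action, on an open normal `N`
  have hg : IsLocallyConstant (Function.uncurry fun σ τ ↦ c.1 (σ, τ)) :=
    (IsLocallyConstant.iff_continuous _).2 c.1.continuous
  obtain ⟨N₀, hN₀⟩ := exists_openNormalSubgroup_forall_mul_eq_of_isLocallyConstant₂ hg
  have hSopen : IsOpen {σ : absoluteGaloisGroup K | ∀ m : M, ρ σ m = m} := by
    have e : {σ : absoluteGaloisGroup K | ∀ m : M, ρ σ m = m} = ⋂ m, {σ | ρ σ m = m} := by ext σ; simp
    rw [e]
    exact isOpen_iInter_of_finite fun m ↦ ρ.isOpen_setOf_apply_eq m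
  obtain ⟨N, hN⟩ := ProfiniteGrp.exist_openNormalSubgroup_sub_open_nhds_of_one
    (hSopen.inter N₀.isOpen) ⟨fun m ↦ by rw [map_one]; rfl, N₀.one_mem⟩
  have hNρ : ∀ σ ∈ N, ∀ m, ρ σ m = m := fun σ hσ ↦ (hN hσ).1
  have hNN₀ : ∀ σ ∈ N, σ ∈ N₀ := fun σ hσ ↦ (hN hσ).2
  -- a finite Galois `E` with `Gal(K̄/E) ≤ N`
  obtain ⟨E, hEfin, hEgal, hE⟩ := exists_isGalois_mem_of_restrict_eq_one K N.isOpen N.one_mem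
  haveI := hEfin
  haveI := hEgal
  filter_upwards [eventually_forall_inertia_mem_fixingSubgroup (F := K) E] with v hv
  set F := v.adicCompletion K with hF
  haveI : CompactSpace (absoluteGaloisGroup F) := absoluteGaloisGroup_compactSpace F
  set r := absGaloisRestrict K F with hr_def
  -- `res (I_{K_v}) ≤ N`
  have hIN : ∀ ι ∈ absInertia F, r ι ∈ N := by
    intro ι hι
    have h1 : r ι ∈ (adicCompletionPrime K v).inertia (absoluteGaloisGroup K) := by
      rw [inertia_adicCompletionPrime_eq_map_absInertia K v]
      exact Subgroup.mem_map_of_mem _ hι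
    have h2 := hv _ (adicCompletionPrime_mem_primesAbove K v) _ h1
    apply hE
    have h3 : r ι ∈ (absRestrictNormalHom (K := K) E).ker := by
      change absoluteGaloisGroup.toAlgEquiv K (r ι) ∈ (AlgEquiv.restrictNormalHom E).ker
      rw [IntermediateField.restrictNormalHom_ker]
      exact h2
    exact h3
  -- the open normal subgroup `U = res⁻¹(N) ⊇ I_{K_v}` of `Γ_{K_v}`
  set U : Subgroup (absoluteGaloisGroup F) := N.toSubgroup.comap r.toMonoidHom with hU_def
  haveI : U.Normal := Subgroup.Normal.comap inferInstance _
  have hIU : absInertia F ≤ U := fun ι hι ↦ hIN ι hι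
  -- the local module and the restricted cocycle
  rw [← hc, localization_two_twoCocycleClass]
  refine twoCocycleClass_eq_zero_of_biinvariant_of_absInertia_le (F := F) (τ := GaloisRep.restrictField F ρ)
    U hIU (fun u hu m ↦ ?_) _ (fun σ τ u₁ hu₁ u₂ hu₂ ↦ ?_)
  · -- `U` acts trivially on `M`
    exact hNρ (r u) hu m
  · -- bi-invariance of the restricted cocycle
    change c.1 (r (σ * u₁), r (τ * u₂)) = c.1 (r σ, r τ)
    rw [map_mul, map_mul]
    exact hN₀ (r σ) (r τ) (r u₁) (hNN₀ _ hu₁) (r u₂) (hNN₀ _ hu₂)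

/-- **All places**: the set of places `v` (archimedean included) with `loc_v x ≠ 0` is finite, for `x ∈ H²(K, M)`, `M` finite —
the infinite places being finitely many.  This is the shape of clause (i) of the named fact `poitouTate_sha_zmod_mu K`, for every
finite discrete module. [cite: MilneADT2006, Ch. I §4, Lemma 4.8] [cite: Harari2020, Prop. 17.6 and Lemma 17.8] -/
theorem finite_setOf_localization_two_ne_zero (ρ : DiscreteGaloisModule K M) (x : galoisCohomology ρ 2) :
    {v : Place K | galoisCohomology.localization ρ v 2 x ≠ 0}.Finite := by
  have hfin : {v : HeightOneSpectrum (𝓞 K) | galoisCohomology.localization ρ (Sum.inr v) 2 x ≠ 0}.Finite := by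
    have h := eventually_localization_two_eq_zero ρ x
    rwa [Filter.eventually_cofinite] at h
  have hsub : {v : Place K | galoisCohomology.localization ρ v 2 x ≠ 0} ⊆
      Set.range (Sum.inl : InfinitePlace K → Place K) ∪
        Sum.inr '' {v : HeightOneSpectrum (𝓞 K) | galoisCohomology.localization ρ (Sum.inr v) 2 x ≠ 0} := by
    rintro (w | v) hv
    · exact Or.inl ⟨w, rfl⟩
    · exact Or.inr ⟨v, hv, rfl⟩
  exact ((Set.finite_range _).union (hfin.image _)).subset hsub

/-- **Clause (i) of the named fact `poitouTate_sha_zmod_mu K`, PROVED**: for every number field `K`, every `m ≥ 1` and every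
`x ∈ H²(K, ℤ/m)` (trivial action), the set of places `v` with `loc_v x ≠ 0` is finite (Harari Lemma 17.8 with Prop. 17.6 in degree
`2`).  The remaining clauses of the fact (Thm. 17.13 (b): finiteness and duality of `Ш¹(K, μ_m)`, `Ш²(K, ℤ/m)`) stay named.
[cite: Harari2020, Lemma 17.8 and Prop. 17.6] [cite: MilneADT2006, Ch. I §4, Lemma 4.8] -/
theorem finite_setOf_localization_two_trivial_zmod_ne_zero {K : Type} [Field K] [NumberField K] (m : ℕ) [NeZero m]
    (x : galoisCohomology (ContinuousRep.trivial (absoluteGaloisGroup K) ℤ (ZMod m)) 2) :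
    {v : Place K | galoisCohomology.localization
      (ContinuousRep.trivial (absoluteGaloisGroup K) ℤ (ZMod m)) v 2 x ≠ 0}.Finite :=
  finite_setOf_localization_two_ne_zero (ContinuousRep.trivial (absoluteGaloisGroup K) ℤ (ZMod m)) x

end Literature.NumberTheory.GaloisCohomology.PoitouTateFinite.SignedEC.H2FiniteSupport

end Part8

/-!
## Part 9 — port of `Summits/BirchSwinnertonDyer/BirchSwinnertonDyer/Theorems/SchneiderFreeAdditiveX3PoitouTateShaZModMuHolds.lean` (4 declarations kept)

# Poitou–Tate duality of `Ш¹(K, μ_m)` and `Ш²(K, ℤ/m)` — the named fact `poitouTate_sha_zmod_mu K` — HOLDS for EVERY number field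

Declarations of this Part (verbatim port; each keeps its own docstring and citation): `pairingCongrRight_bijective`, `flip_pairingCongrRight`, `pairingCongrRight_flip_bijective`, `poitouTate_sha_zmod_mu_holds`.

Reference keys (see `references.bib` and the declarations' citations): [MilneADT2006], [Harari2020], [Tate1963DualityICM].
-/

section Part9

namespace Literature.NumberTheory.GaloisCohomology.PoitouTateFinite.PoitouTateReduction

open Literature.NumberTheory.GaloisRepresentations Literature.NumberTheory.GaloisCohomology
open Literature.NumberTheory.GaloisRepresentations.DiscreteGaloisModule
open _root_.Field _root_.Function _root_.NumberField
open scoped ContRepresentation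

section Pairing

variable {A B B' C : Type*} [AddCommGroup A] [AddCommGroup B] [AddCommGroup B'] [AddCommGroup C]

/-- The left adjoint of the re-indexed pairing is bijective if the original one is. [cite: MilneADT2006, Ch. I §4, Thm. 4.10 (with M = ℤ/m, M^D = μ_m)] -/
theorem pairingCongrRight_bijective {b : A →+ B →+ C} (hb : Bijective b) (e : B ≃+ B') :
    Bijective (pairingCongrRight b e) :=
  (e.addMonoidHomCongrLeft (N := C)).bijective.comp hb

/-- The right adjoint of the re-indexed pairing is the original right adjoint precomposed with `e⁻¹`. [cite: MilneADT2006, Ch. I §4, Thm. 4.10 (with M = ℤ/m, M^D = μ_m)] -/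
theorem flip_pairingCongrRight (b : A →+ B →+ C) (e : B ≃+ B') :
    (pairingCongrRight b e).flip = b.flip.comp e.symm.toAddMonoidHom :=
  AddMonoidHom.ext fun _ => AddMonoidHom.ext fun _ => rfl

/-- The right adjoint of the re-indexed pairing is bijective if the original one is. [cite: MilneADT2006, Ch. I §4, Thm. 4.10 (with M = ℤ/m, M^D = μ_m)] -/
theorem pairingCongrRight_flip_bijective {b : A →+ B →+ C} (hb : Bijective b.flip) (e : B ≃+ B') :
    Bijective (pairingCongrRight b e).flip := by
  rw [flip_pairingCongrRight]
  exact hb.comp e.symm.bijective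

end Pairing

section Holds

open Literature.NumberTheory.GaloisCohomology.PoitouTateFinite.SignedEC.H2FiniteSupport
  (finite_setOf_localization_two_trivial_zmod_ne_zero)

/-- **Poitou–Tate duality of `Ш¹(K, μ_m)` and `Ш²(K, ℤ/m)`, with the finiteness of the support of global
`H²(K, ℤ/m)`-classes — the named fact `poitouTate_sha_zmod_mu K` — for EVERY number field `K`.**
Clause (i) (Harari Lemma 17.8 with Prop. 17.6 in degree `2`) is bsd-wall's theorem
`finite_setOf_localization_two_trivial_zmod_ne_zero` (every finite module); clauses (ii)–(iv) (Harari Thm. 17.13 (b) for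
`M = ℤ/m`, `M' = μ_m`) are the case `ρ = ℤ/m` (trivial action), `n = m` of the general duality
`poitouTate_sha_tateDual_holds K` (Milne I Thm. 4.10 (a)), transported along the `Γ_K`-isomorphism
`(ℤ/m)^D = Hom(ℤ/m, μ_m) ≅ μ_m`, `f ↦ f 1` (`shaTateDualTrivEquiv`). A published theorem re-proved in the tree; not a case of BSD.
[cite: Harari2020, Thm. 17.13 (b), Lemma 17.8, Prop. 17.6][cite: MilneADT2006, Ch. I, Thm. 4.10 (a), Lemma 4.8][cite: Tate1963DualityICM, Thm. 3.1] -/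
theorem _root_.Literature.NumberTheory.GaloisCohomology.poitouTate_sha_zmod_mu_holds (K : Type) [Field K] [NumberField K] : poitouTate_sha_zmod_mu K := by
  intro m _
  obtain ⟨hfin, hfin₂, b, hb, hbf⟩ :=
    poitouTate_sha_tateDual_holds K m (ZMod m) (trivZMod K m) (nsmul_zmod_eq_zero m)
  refine ⟨finite_setOf_localization_two_trivial_zmod_ne_zero m, ?_, hfin₂,
    pairingCongrRight b (shaTateDualTrivEquiv K m), pairingCongrRight_bijective hb _,
    pairingCongrRight_flip_bijective hbf _⟩
  exact Finite.of_equiv _ (shaTateDualTrivEquiv K m).toEquiv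

end Holds

end Literature.NumberTheory.GaloisCohomology.PoitouTateFinite.PoitouTateReduction

end Part9

/-!
## Part 10 — port of `Summits/BirchSwinnertonDyer/BirchSwinnertonDyer/Theorems/SchneiderFreeAdditiveX3TateH2VanishingAllNumberFields.lean` (4 declarations kept)

# Tate's theorem `H²(Γ_K, ℚ/ℤ) = 0` for EVERY number field, unconditional; the Patrikis lifting facts HOLD

Declarations of this Part (verbatim port; each keeps its own docstring and citation): `tate_twoCocycle_addCircle_split`, `Patrikis2019_exists_lift_projective_holds`, `Patrikis2019_exists_spinLift_holds`, `Patrikis2019_exists_spinLift_of_continuous_holds`.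

Reference keys (see `references.bib` and the declarations' citations): [SerreDurham1977], [Harari2020], [Patrikis2019].
-/

section Part10

set_option autoImplicit false
namespace Literature.NumberTheory.GaloisCohomology.PoitouTateFinite.PoitouTateReduction

open Literature.NumberTheory.GaloisRepresentations Literature.NumberTheory.GaloisCohomology
open _root_.Field _root_.Function _root_.NumberField

section Tate

/-- **Tate's theorem `H²(Γ_K, ℚ/ℤ) = 0` in cochain form, for EVERY number field `K`, unconditionally**
(Serre, Durham §6.1 Thm. 4: *"If `K` is a local or global field, `H²(G_K, ℚ/ℤ) = 0`"*): every locally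
constant `2`-cocycle `Γ_K × Γ_K → ℚ/ℤ` (trivial action) is the coboundary of a locally constant cochain —
`twoCocycle_addCircle_split_of_poitouTate_of_realThree` with both named facts discharged
(`poitouTate_sha_zmod_mu_holds`, `poitouTate_three_realPlaces_injective_holds`).
[cite: SerreDurham1977, §6.1 Thm. 4 (Tate)] [cite: Harari2020, Cor. 18.17] -/
theorem tate_twoCocycle_addCircle_split (K : Type) [Field K] [NumberField K]
    (f : absoluteGaloisGroup K → absoluteGaloisGroup K → AddCircle (1 : ℚ))
    (hf : IsLocallyConstant (Function.uncurry f))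
    (hcoc : ∀ σ τ υ, f σ τ + f (σ * τ) υ = f τ υ + f σ (τ * υ)) :
    ∃ b : absoluteGaloisGroup K → AddCircle (1 : ℚ), IsLocallyConstant b ∧
      ∀ σ τ, f σ τ + b (σ * τ) = b σ + b τ :=
  twoCocycle_addCircle_split_of_poitouTate_of_realThree (fun K _ _ => poitouTate_sha_zmod_mu_holds K) K
    (poitouTate_three_realPlaces_injective_holds K) f hf hcoc

end Tate

section Patrikis

/-- **The named fact `Patrikis2019_exists_lift_projective` HOLDS** (Patrikis 2019, §2.1 Theorem (Tate) =
arXiv Thm. 1.0.16 with Prop. 1.0.18 and Remark: every continuous projective representation of `Γ_F`,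
`F` a number field, lifts with control of ramification) — `Patrikis2019_exists_lift_projective_of_H2_addCircle`
fed with Tate's theorem for every number field.
[cite: Patrikis2019, §2.1 Theorem (Tate) = arXiv Thm. 1.0.16, Prop. 1.0.18 and Remark] [cite: SerreDurham1977, §6.1 Thm. 4] -/
theorem _root_.Literature.NumberTheory.GaloisRepresentations.Patrikis2019_exists_lift_projective_holds : Patrikis2019_exists_lift_projective :=
  Patrikis2019_exists_lift_projective_of_H2_addCircle fun K _ _ f hf hcoc =>
    tate_twoCocycle_addCircle_split K f hf hcoc

/-- **The named fact `Patrikis2019_exists_spinLift` HOLDS** (Patrikis §2.1 Proposition and Remark for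
`GSpin₆ ↠ SO₆`, via `Patrikis2019_exists_spinLift_of_lift_projective`).
[cite: Patrikis2019, §2.1 Proposition and Remark (= arXiv Prop. 1.0.18, Rem. 1.0.19)] -/
theorem _root_.Literature.NumberTheory.GaloisRepresentations.Patrikis2019_exists_spinLift_holds : Patrikis2019_exists_spinLift :=
  Patrikis2019_exists_spinLift_of_lift_projective Patrikis2019_exists_lift_projective_holds

/-- **The named fact `Patrikis2019_exists_spinLift_of_continuous` HOLDS** (the ramification-free spin
lift `∧²W ≅ ν ⊗ r` for a continuous `r : Γ_F → SO₆(ℚ̄_ℓ)`; Patrikis §2.1 Proposition = Conrad Prop. 5.3),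
via the tree's `Patrikis2019_exists_spinLift_of_continuous_of_H2_addCircle` and Tate's theorem for
every number field. [cite: Patrikis2019, Ch. 2 §2.1, Proposition (= arXiv Prop. 1.0.18)] -/
theorem _root_.Literature.NumberTheory.GaloisRepresentations.Patrikis2019_exists_spinLift_of_continuous_holds : Patrikis2019_exists_spinLift_of_continuous :=
  fun F _ _ ℓ _ r hJ hdet =>
    Patrikis2019_exists_spinLift_of_continuous_of_H2_addCircle
      (fun K _ _ f hf hcoc => tate_twoCocycle_addCircle_split K f hf hcoc) F ℓ r hJ hdet

end Patrikis

end Literature.NumberTheory.GaloisCohomology.PoitouTateFinite.PoitouTateReduction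

end Part10

/-!
## Part 11 — port of `Summits/BirchSwinnertonDyer/BirchSwinnertonDyer/Theorems/PoitouTateSelmerStructureDualityConjHolds.lean` (1 declarations kept)

# `poitouTate_selmerStructure_duality_conj K` HOLDS for every number field `K` — Poitou–Tate duality for Selmer structures in the CONJUGATION-COMPATIBLE currency, witnessed by THE canonical local invariants

Declarations of this Part (verbatim port; each keeps its own docstring and citation): `poitouTate_selmerStructure_duality_conj_holds`.

Reference keys (see `references.bib` and the declarations' citations): [MilneADT2006], [Howard2004HeegnerKolyvagin].
-/

section Part11

set_option autoImplicit false

namespace Literature.NumberTheory.GaloisCohomology.PoitouTateFinite.InputsPoitouTateSelmer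

open Literature.NumberTheory.GaloisCohomology

section ConjHolds

/-! The one parameter of the named fact (the number field); the discharge below is the closed statement at every `K`. -/
variable (K : Type) [Field K] [NumberField K]

/-- **`poitouTate_selmerStructure_duality_conj K` for EVERY number field `K`** (Milne *ADT* I Cor. 2.3 ∧ Thm. 4.10 (b) ∧ Thm. 2.6 ∧
Howard 2004 Thm. 2.1.11, conjugation-compatible currency), for THE canonical local invariants:
`poitouTate_selmerStructure_duality_conj_of_canonical_numberField` with `UnramifiedOrthogonal` from
`PoitouTateReduction.unramifiedOrthogonal_of_isPerfect_allLevels` and `SelmerComplement` from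
`PoitouTateReduction.selmerComplement_canonical_holds` (p626891). Unconditional; BSD is not proved by this.
[cite: MilneADT2006, Ch. I, Thm. 4.10 (b) (proof, p. 58), Cor. 2.3, Thm. 2.6] [cite: Howard2004HeegnerKolyvagin, Thm. 2.1.11 (arXiv:1202.6340 p. 6)] -/
theorem _root_.Literature.NumberTheory.GaloisCohomology.poitouTate_selmerStructure_duality_conj_holds : poitouTate_selmerStructure_duality_conj K :=
  poitouTate_selmerStructure_duality_conj_of_canonical_numberField K
    (fun n _ => PoitouTateReduction.unramifiedOrthogonal_of_isPerfect_allLevels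
      (LocalInvariants.canonical K n) LocalInvariants.canonical_isPerfect)
    (fun n _ => PoitouTateReduction.selmerComplement_canonical_holds K n)

end ConjHolds

end Literature.NumberTheory.GaloisCohomology.PoitouTateFinite.InputsPoitouTateSelmer

end Part11

/-!
## Part 12 — port of `Summits/BirchSwinnertonDyer/BirchSwinnertonDyer/Theorems/HowardThm161PrintIntendedOfProp141Intended.lean` (1 declarations kept)

# Howard 2004, Thm. 1.6.1 as intended by its printed proof from Prop. 1.4.1 as intended — Poitou–Tate duality discharged by the tree

Declarations of this Part (verbatim port; each keeps its own docstring and citation): `thm161_printIntended_of_prop141_printIntended`.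

Reference keys (see `references.bib` and the declarations' citations): [Howard2004HeegnerKolyvagin], [MilneADT2006].
-/

section Part12

set_option autoImplicit false

namespace Literature.NumberTheory.GaloisCohomology.PoitouTateFinite.HowardThm161PrintIntended

open Literature.NumberTheory.GaloisCohomology
open Literature.NumberTheory.GaloisCohomology.Howard2004

/-- **Howard 2004, Thm. 1.6.1 as intended by its printed proof (F-161′) from the print-as-intended leaf C45.1″ alone**:
`prop141_casselsTate_skewPairing_atLevel_printIntended → thm161_dvrKolyvaginBound_printIntended`, Poitou–Tate duality for
Selmer structures being supplied by the tree (`poitouTate_selmerStructure_duality_conj_holds`).  Conditional on C45.1″; the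
as-worded F-161 is not proved; BSD is not proved by this.
[cite: Howard2004HeegnerKolyvagin, Thm. 1.6.1 (arXiv:1202.6340 Thm. 2.6.1, p. 11 L17–32), Prop. 1.4.1, Thm. 1.4.2, Lemma 1.5.1]
[cite: MilneADT2006, Ch. I, Thm. 4.10 (b)] -/
theorem thm161_printIntended_of_prop141_printIntended
    (h141 : prop141_casselsTate_skewPairing_atLevel_printIntended) :
    thm161_dvrKolyvaginBound_printIntended :=
  DVRSetting.thm161_printIntended_of_prop141_printIntended h141 fun K _ _ =>
    poitouTate_selmerStructure_duality_conj_holds K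

end Literature.NumberTheory.GaloisCohomology.PoitouTateFinite.HowardThm161PrintIntended

end Part12

/-!
## Part 13 — port of `Summits/BirchSwinnertonDyer/BirchSwinnertonDyer/Theorems/HowardFlachSkewPairingAtLevelIntendedHolds.lean` (2 declarations kept)

# Howard 2004 Prop. 1.4.1 / Thm. 1.4.2 PRINT-AS-INTENDED HOLDS; Howard Thm. 1.6.1 as intended, unconditionally

Declarations of this Part (verbatim port; each keeps its own docstring and citation): `prop141_casselsTate_skewPairing_atLevel_printIntended_holds`, `thm161_printIntended_holds`.

Reference keys (see `references.bib` and the declarations' citations): [Howard2004HeegnerKolyvagin], [Flach1990], [MilneADT2006], [TateGCFT1967].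
-/

section Part13

set_option autoImplicit false

namespace Literature.NumberTheory.GaloisCohomology.PoitouTateFinite.HowardFlachSkewPairingIntended

open Literature.NumberTheory.GaloisCohomology
open Literature.NumberTheory.GaloisCohomology.Howard2004

/-- **C45.1″ — Howard 2004 Prop. 1.4.1 with the displays of Thm. 1.4.2, PRINT-AS-INTENDED — as a KERNEL THEOREM (no hypothesis)**:
LEAD g14's `prop141_casselsTate_skewPairing_atLevel_printIntended_of_poitouTate` (the class-level port of Flach's pairing on the level
tower, cell bricks Q0–Q7) fed with the tree's Čebotarev theorem for Artin representations and the two Poitou–Tate duality theorems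
(`poitouTate_sha_tateDual_holds`, `poitouTate_selmerStructure_duality_conj_holds`).  A published theorem re-proved; not a case of BSD.
[cite: Howard2004HeegnerKolyvagin, Prop. 1.4.1, Thm. 1.4.2 and Lemma 1.5.1 (arXiv:1202.6340 p0008 L83–L142, p0009 L127–133)]
[cite: Flach1990, Thm. 1 and Thm. 2] [cite: MilneADT2006, Ch. I, Thm. 4.10] [cite: TateGCFT1967, §2.4] -/
theorem _root_.Literature.NumberTheory.GaloisCohomology.Howard2004.prop141_casselsTate_skewPairing_atLevel_printIntended_holds :
    Literature.NumberTheory.GaloisCohomology.Howard2004.prop141_casselsTate_skewPairing_atLevel_printIntended :=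
  prop141_casselsTate_skewPairing_atLevel_printIntended_of_poitouTate
    Literature.NumberTheory.Automorphic.chebotarev_artinRep_of_galoisSide
    (fun K _ _ => poitouTate_sha_tateDual_holds K)
    (fun K _ _ => poitouTate_selmerStructure_duality_conj_holds K)

/-- **Howard 2004 Thm. 1.6.1 AS INTENDED BY ITS PRINTED PROOF (F-161′, `thm161_dvrKolyvaginBound_printIntended`) — UNCONDITIONAL**:
x10b-p1-w7 g12's Summits twin `HowardThm161PrintIntended.thm161_printIntended_of_prop141_printIntended : C45.1″ → F-161′` (over the cell's
G87 engine closing file `Howard2004/Thm161PrintIntendedOfEngineBricks`) applied to `prop141_casselsTate_skewPairing_atLevel_printIntended_holds`.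
The AS-WORDED F-161 (`thm161_dvrKolyvaginBound`, item 23087) is NOT proved; not a case of BSD.
[cite: Howard2004HeegnerKolyvagin, Thm. 1.6.1 (arXiv:1202.6340 Thm. 2.6.1, p. 11 L17–32; print-as-intended scope p0004 L47–52, p0006 L84–92), Prop. 1.4.1, Thm. 1.4.2, Lemma 1.5.1]
[cite: MilneADT2006, Ch. I, Thm. 4.10 (b)] -/
theorem _root_.Literature.NumberTheory.GaloisCohomology.Howard2004.thm161_dvrKolyvaginBound_printIntended_holds : thm161_dvrKolyvaginBound_printIntended :=
  HowardThm161PrintIntended.thm161_printIntended_of_prop141_printIntended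
    prop141_casselsTate_skewPairing_atLevel_printIntended_holds

end Literature.NumberTheory.GaloisCohomology.PoitouTateFinite.HowardFlachSkewPairingIntended

end Part13

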